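import Literature.MathematicalPhysics.QuantumFieldTheory.Balaban1983to89.B6Lemma24TwoScaleComposite
import Literature.MathematicalPhysics.QuantumFieldTheory.Balaban1983to89.B6Lemma24Printed

/-!
# `Balaban1983to89.B6Lemma24TwoScaleBookkeeping` — T. Bałaban, *Propagators and renormalization transformations for lattice gauge theories. II*,
# Commun. Math. Phys. **96** (1984) 223–250 [Balaban1984PropagatorsII], Lemma 2.4 (2.128) p. 245 with (2.121)–(2.127) pp. 244–245, for the TWO-LEVEL CUBE
# (2.89) p. 239: **THE BOOKKEEPING OF THE TWO-SCALE LEMMA-2.4 LETTER ON b06's ℤᵈ CARRIER** (coverage, vanishing, absorptions by end type)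

statement-level skeleton of published theorems with citation tags; proofs where landed; nothing here is a claim about the Yang–Mills mass gap

PDF held: `paper:balaban1984-cmp96-propagators-rt-ii` (journal page = PDF page + 222), pp. 239, 244–245 (text layer read by the lane, 2026-08-28).

CITATION HEADER (lean-in-tree rule).  Cell `pub-ymgap` (Track A, HUMAN RULING D-0062), node N10 [B13] lane owner `pub-ymgap-dag-n10-c` (g18), ROAD «C» station C6b
(design `HOME/pub-ymgap-dag-n10-c/C6-DESIGN.md`, bus INBOX 2026-08-28T16:55Z ∕ INTENT-1 17:54Z), filed `--supports stmt-QuantumFields-27364` (count-neutral helper).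
WHY: the Lemma-2.4 letter `κ‖B‖² ≤ ‖∂B‖² + Σ_𝔅 w(QB)²` of `B6SectADeltaACoerciveReductionV1` (C1) is proved at ONE level (`B6SectALemma24OneLevelV1`, C4); for a
cube meeting `Ω_{j+1}` — print's two-level cube (2.89) *«B^j(Λ) = □̃ ∩ B^{j+1}(Λ_{j+1})»*, with `Q_{j+1}` on `B^j(Λ)` and `Q_j` on `□̃ ∖ B^j(Λ)` — the `j`-bonds from the
level-`j` region into the deeper region are NOT indices of `𝔅` (r03's reading `B6SectADomainsV1.Domains.LamBond`: no end point deep), so their `(Q_jB)²` may not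
appear on the right side; they are read instead at scale `L^{j+1}` through the big bonds `⟨Y₀, Y⟩`, `Y` a big block, `Y₀` the adjacent COMPOSITE `(j+1)`-position of
the level-`j` region.  This file is the Finset bookkeeping of that two-scale assembly on b06's ℤᵈ carrier (small side `n`, big side `N = nL`); the scalar assembly and
the inequality itself are `B6Lemma24TwoScale`.  IMPORTS `B6Lemma24TwoScaleComposite` (C6a: `subCorners`, the composite-block decompositions) and pv09's
`B6Lemma24Printed` (the per-face split `face_split`, the layer-restricted Poincaré inequality `layer_sq_le`, through it `B6Lemma24Assembly` ∕ `B6Lemma24Carrier` ∕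
`B6FaceInterpolation` ∕ `B6TreeGaugePoincare` ∕ `B6Elimination`); nothing restated.

THE PRINT (verbatim, p. 245): *«Lemma 2.4. Let a set Λ ⊂ Z^d be a sum of blocks, Λ = B(Λ′). We denote by Λ also a set of bonds b such that at least one of the
end-points b₋, b₊ belongs to Λ. Let B be a configuration defined on Λ and satisfying the condition (2.121) … We put B = 0 outside Λ. Then …
L^{d−2} Σ_{c∈Λ′} |(Q₁B)(c)|² + Σ_p |(∂₁B)(p)|² ≥ (1∕(12d²)) L^{−d−1} ‖B‖². (2.128)»*; p. 239: *«We define B^j(Λ) = □̃ ∩ B^{j+1}(Λ_{j+1}), (2.89) and we take Q′*aQ′,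
Q*aQ equal to Q′*_{j+1}a_{j+1}Q′_{j+1}, Q*_{j+1}a_{j+1}Q_{j+1} on B^j(Λ), and to Q′*_ja_jQ′_j, Q*_ja_jQ_j on □̃ ∖ B^j(Λ)»*.

THE TWO-SCALE DATA (`n, L ≥ 1`, `N = n·L`).  `Λs ⊂ nℤᵈ` (small corners: the level-`j` blocks), `Λb ⊂ Nℤᵈ` (big corners: the level-`(j+1)` blocks), the regions
`Λ^S = B_n(Λs)`, `Λ^B = B_N(Λb)` DISJOINT (`hdisj : corner_N y ∉ Λb` for `y ∈ Λs`); `bonds₂ = lamBonds n Λs ∪ lamBonds N Λb` (bonds with an end point in `Λ^S ∪ Λ^B`),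
`normSq₂ = Σ_{bonds₂} B²`; `B = 0` off `bonds₂`, tree gauge (2.121) in every block of `Λs` (scale `n`) and of `Λb` (scale `N`).  `idxS` = the SMALL INDICES: small coarse
bonds `⟨y, y + n e_μ⟩` meeting `Λs` whose two end blocks are not inside big blocks; the big indices are ALL coarse `N`-bonds meeting `Λb` (pv09 `coarseBonds N Λb`).
ADMISSIBILITY `Adm Y` of an `N`-position `Y`: `Y ∈ Λb`, or COMPOSITE (`subCorners n L Y ⊆ Λs`), or EMPTY (`subCorners n L Y` disjoint from `Λs`) — required of every
`N`-neighbour `Y ± N e_μ` of a big block (at a two-level cube this is the separation (2.2) of the domains).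

WHAT IS DEFINED (bodies displayed): `bonds₂`, `normSq₂`, `idxS`, `crossS` (small crossing sum over `idxS`), `crossB` (big crossing sum), `compG` (the composite quantity
of an `N`-position: its sub-blocks' inner sums + its internal small faces' crossing sums — the right side of C6a's decompositions at `f = B²`), `Adm`, `faceIdx`.
WHAT IS PROVED (sorry-free; standard axioms; all [folklore] lattice bookkeeping over the kernel theorems of pv09 ∕ C6a):
* §2 `small_block_subset_big` (`B_n(y) ⊆ B_N(corner_N y)` for `y ∈ nℤᵈ`), `corner_big_of_mem_subCorners`; ★ `eq_zero_of_innerBonds_small` (`B = 0` inside a small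
  block `∉ Λs` not inside a big block), ★ `eq_zero_of_innerBonds_bigEmpty` (`B = 0` inside an empty `N`-position `∉ Λb`).
* §3 ★★ `crossing_cover₂`: `normSq₂ − N_in^S − N_in^B ≤ crossS + crossB` — a bond of the two regions is inside a small block, inside a big block, crosses a small face of
  `idxS`, or crosses a big face (the interface small∕big INCLUDED, read at scale `N`); no admissibility needed.
* §4 the small faces over `idxS`: `sum_face_split_idxS` (pv09 `face_split` at scale `n`, summed), `sum_blockSq_idxS_minus_le` ∕ `…_plus_le` (`≤ d·N_in^S`),
  `sum_layerLast_idxS_le` ∕ `sum_layerFirst_idxS_le` (`≤ (d−1)(n−1)n^{d−2}·d·P_in^S`, pv09 `layer_sq_le`), `faces_idxS_le` (`≤ d1Sq n Λs − P_in^S`, pv09 `faces_le_pCr`).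
* §5 the big faces over `coarseBonds N Λb`, by END TYPE under `Adm`: `inner_big_le`, `layerLast_big_le`, `layerFirst_big_le` (big block: pv09; composite: C6a
  `sum_innerBonds_big_le` ∕ `sum_bondsIn_lastLayer_big_le` ∕ `sum_bondsIn_firstLayer_big_le` ⇒ `compG`; empty: `0`); ★★ `sum_compG_le` (the composite quantities of
  DISTINCT positions sum to `≤ N_in^S + crossS`: fibres of `corner_N`, `faceIdx_subset_idxS`); the four sums ★★ `sum_innerMinus_big_le` ∕ `sum_innerPlus_big_le`
  (`≤ d·N_in^B + d·(N_in^S + crossS)`), ★★ `sum_layerLast_big_le` ∕ `sum_layerFirst_big_le` (`≤ (d−1)(N−1)N^{d−2}·d·P_in^B + d·(N_in^S + crossS)`).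
* §6 (v1.1, append-only) ★★ ADMISSIBILITY-FREE editions: an end of a big face outside `Λb` is a GENERALISED composite position — its sub-blocks outside `Λs` have
  vanishing inner sums and its internal faces not meeting `Λs` vanishing crossing sums («B = 0 outside Λ») — so `sum_compG_le_noAdm` (positions `∉ Λb` instead of
  `⊆ Λs`), `inner_big_le_noAdm` ∕ `layerLast_big_le_noAdm` ∕ `layerFirst_big_le_noAdm` (dichotomy `Y ∈ Λb` ∕ `Y ∉ Λb`, no hypothesis) and the four sums
  `sum_innerMinus∕innerPlus∕layerLast∕layerFirst_big_le_noAdm` hold WITHOUT `Adm`∕`hH` and without `hdisj` (consumed by `B6Lemma24TwoScale.lemma24_twoScale_noAdm`).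
HONEST SCOPE.  Finset bookkeeping and the vanishing of `B` outside the regions; the only analytic inputs are pv09's kernel theorems (per face, gauge-free, or in the tree
gauge of ONE block) and C6a's decompositions.  The two-scale set-up is the cell's construction for print's (2.89), not a printed display; nothing of the paper is
asserted; NOT a node discharge; count-neutral; nothing continuum ∕ OS ∕ mass gap ∕ Clay.
-/

namespace Literature.MathematicalPhysics.QuantumFieldTheory.Balaban1983to89.B6Lemma24TwoScaleBookkeeping

open Finset
open B6Elimination (block mem_block corner corner_apply corner_le lt_corner_add mem_block_corner corner_eq_of_mem_block
  corner_eq_self_of_dvd mem_block_corner_iff corner_corner)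
open B6BondElimination (unitVec unitVec_apply add_unitVec_apply add_smul_unitVec_apply sub_smul_unitVec_apply treeBonds mem_treeBonds)
open B6TreeGaugePoincare (Cfg curl innerBonds innerPlaq mem_innerBonds mem_innerBonds_iff mem_innerPlaq)
open B6FaceInterpolation (lastLayer firstLayer bondsIn mem_lastLayer mem_firstLayer mem_bondsIn add_unitVec_mem_firstLayer
  firstLayer_subset_block lastLayer_subset_block)
open B6Lemma24Carrier (lam mem_lam lamBonds mem_lamBonds nIn pIn d1Sq coarseBonds q1Term q1Of eq_of_mem_block pairwiseDisjoint_innerBonds)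
open B6Lemma24Assembly (mem_coarseBonds dvd_of_mem_coarseBonds innerBonds_not_mem_lamBonds faces_le_pCr)
open B6Lemma24Printed (layer_sq_le layerCoeff_nonneg bondsIn_lastLayer_subset bondsIn_firstLayer_subset sum_ite_blockPlaq_le face_split)
open B6Lemma24Kappa (LayerIneq)
open B6Lemma24TwoScaleComposite (subCorners mem_subCorners_iff block_sub_subset corner_mem_subCorners sum_innerBonds_big_le
  sum_bondsIn_lastLayer_big_le sum_bondsIn_firstLayer_big_le)

noncomputable section

variable {d : ℕ} {n L : ℕ}

/-! ## §0. Two private summation helpers -/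

/-- sums of a nonnegative function: over a subset of `A ∪ B` at most the sum over `A` plus the sum over `B`. [folklore] -/
private theorem sum_le_sum_add_sum_of_subset_union {α : Type*} [DecidableEq α] {S A B : Finset α} (h : S ⊆ A ∪ B) {f : α → ℝ}
    (hf : ∀ a, 0 ≤ f a) : ∑ a ∈ S, f a ≤ ∑ a ∈ A, f a + ∑ a ∈ B, f a := by
  calc ∑ a ∈ S, f a ≤ ∑ a ∈ A ∪ B, f a := sum_le_sum_of_subset_of_nonneg h fun a _ _ => hf a
    _ ≤ ∑ a ∈ A ∪ B, f a + ∑ a ∈ A ∩ B, f a := le_add_of_nonneg_right (sum_nonneg fun a _ => hf a)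
    _ = ∑ a ∈ A, f a + ∑ a ∈ B, f a := sum_union_inter

/-- `Σ_{⋃ᵢ tᵢ} g ≤ Σᵢ Σ_{tᵢ} g` for nonnegative `g` (multiplicities only help). [folklore] -/
private theorem sum_biUnion_le_of_nonneg {ι β : Type*} [DecidableEq ι] [DecidableEq β] (I : Finset ι) (t : ι → Finset β) {g : β → ℝ}
    (hg : ∀ b, 0 ≤ g b) : ∑ b ∈ I.biUnion t, g b ≤ ∑ i ∈ I, ∑ b ∈ t i, g b := by
  induction I using Finset.induction_on with
  | empty => simp
  | insert a I ha ih =>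
    rw [biUnion_insert, sum_insert ha]
    exact (sum_le_sum_add_sum_of_subset_union (subset_of_eq rfl) hg).trans (add_le_add le_rfl ih)

/-! ## §1. The two-scale data: small corners `Λs ⊂ nℤᵈ`, big corners `Λb ⊂ (nL)ℤᵈ`, the bonds of the two regions, the small indices -/

/-- the bonds of the two regions: bonds of ℤᵈ with at least one end point in `Λ^S = B_n(Λs)` or in `Λ^B = B_{nL}(Λb)`.
[cite: Balaban1984PropagatorsII, Lemma 2.4 p.245, (2.89) p.239] -/
def bonds₂ (n L : ℕ) (Λs Λb : Finset (Fin d → ℤ)) : Finset ((Fin d → ℤ) × Fin d) := lamBonds n Λs ∪ lamBonds (n * L) Λb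

/-- `‖B‖²` over the bonds of the two regions. [cite: Balaban1984PropagatorsII, Lemma 2.4 (2.128) p.245, (2.89) p.239] -/
def normSq₂ (n L : ℕ) (Λs Λb : Finset (Fin d → ℤ)) (B : Cfg d) : ℝ := ∑ b ∈ bonds₂ n L Λs Λb, B b ^ 2

/-- the SMALL INDICES: the small coarse bonds `c = ⟨y, y + n e_μ⟩` meeting `Λs` whose two end blocks `B_n(y)`, `B_n(y + n e_μ)` are NOT inside a big block of `Λb`
(print's `Q_j`-constraints on `□̃ ∖ B^j(Λ)`: a `j`-bond into the deeper region is not an index). [cite: Balaban1984PropagatorsII, (2.89) p.239, (2.3) p.224] -/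
def idxS (n L : ℕ) (Λs Λb : Finset (Fin d → ℤ)) : Finset ((Fin d → ℤ) × Fin d) :=
  (coarseBonds n Λs).filter fun c => corner (n * L) c.1 ∉ Λb ∧ corner (n * L) (c.1 + (n : ℤ) • unitVec c.2) ∉ Λb

/-- the small crossing sum: `Σ_{c ∈ idxS} Σ_{x ∈ Δ′_n(c)} B_μ(x)²`. [cite: Balaban1984PropagatorsII, (2.124)–(2.127) p.245] -/
def crossS (n L : ℕ) (Λs Λb : Finset (Fin d → ℤ)) (B : Cfg d) : ℝ :=
  ∑ c ∈ idxS n L Λs Λb, ∑ x ∈ lastLayer n c.1 c.2, B (x, c.2) ^ 2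

/-- the big crossing sum: `Σ_{C meeting Λb} Σ_{x ∈ Δ′_{nL}(C)} B_μ(x)²`. [cite: Balaban1984PropagatorsII, (2.124)–(2.127) p.245] -/
def crossB (n L : ℕ) (Λb : Finset (Fin d → ℤ)) (B : Cfg d) : ℝ :=
  ∑ C ∈ coarseBonds (n * L) Λb, ∑ x ∈ lastLayer (n * L) C.1 C.2, B (x, C.2) ^ 2

/-- the composite quantity of an `nL`-position `Y₀`: its sub-blocks' inner sums plus its internal small faces' crossing sums (the right side of
`B6Lemma24TwoScaleComposite.sum_innerBonds_big_le` ∕ `sum_bondsIn_lastLayer_big_le` at `f = B²`). [cite: Balaban1984PropagatorsII, (2.89) p.239, (2.123)–(2.127) pp.244–245] -/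
def compG (n L : ℕ) (B : Cfg d) (Y₀ : Fin d → ℤ) : ℝ :=
  ∑ s ∈ subCorners n L Y₀, ∑ b ∈ innerBonds n s, B b ^ 2 +
    ∑ s ∈ subCorners n L Y₀, ∑ ν ∈ univ.filter (fun ν : Fin d => s + (n : ℤ) • unitVec ν ∈ subCorners n L Y₀), ∑ z ∈ lastLayer n s ν, B (z, ν) ^ 2

/-- ADMISSIBILITY of an `nL`-position next to a big block: it is a big block of `Λb`, or COMPOSITE (all its `n`-sub-corners in `Λs`), or EMPTY (none of them in `Λs`)
— dischargeable at a two-level cube from the separation (2.2). [cite: Balaban1984PropagatorsII, (2.2) p.224, (2.89) p.239] -/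
def Adm (n L : ℕ) (Λs Λb : Finset (Fin d → ℤ)) (Y : Fin d → ℤ) : Prop :=
  Y ∈ Λb ∨ subCorners n L Y ⊆ Λs ∨ Disjoint (subCorners n L Y) Λs

/-- `compG ≥ 0`. [cite: Balaban1984PropagatorsII, (2.89) p.239; folklore] -/
theorem compG_nonneg (B : Cfg d) (Y₀ : Fin d → ℤ) : 0 ≤ compG n L B Y₀ :=
  add_nonneg (sum_nonneg fun _ _ => sum_nonneg fun _ _ => sq_nonneg _)
    (sum_nonneg fun _ _ => sum_nonneg fun _ _ => sum_nonneg fun _ _ => sq_nonneg _)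

/-- `crossS ≥ 0`. [cite: Balaban1984PropagatorsII, (2.124)–(2.127) p.245; folklore] -/
theorem crossS_nonneg (Λs Λb : Finset (Fin d → ℤ)) (B : Cfg d) : 0 ≤ crossS n L Λs Λb B :=
  sum_nonneg fun _ _ => sum_nonneg fun _ _ => sq_nonneg _

/-- membership in the small indices. [cite: Balaban1984PropagatorsII, (2.89) p.239; folklore] -/
theorem mem_idxS {Λs Λb : Finset (Fin d → ℤ)} {c : (Fin d → ℤ) × Fin d} :
    c ∈ idxS n L Λs Λb ↔ c ∈ coarseBonds n Λs ∧ corner (n * L) c.1 ∉ Λb ∧ corner (n * L) (c.1 + (n : ℤ) • unitVec c.2) ∉ Λb := by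
  rw [idxS, mem_filter]

/-- `idxS ⊆ coarseBonds n Λs`. [cite: Balaban1984PropagatorsII, (2.89) p.239; folklore] -/
theorem idxS_subset (Λs Λb : Finset (Fin d → ℤ)) : idxS n L Λs Λb ⊆ coarseBonds n Λs := filter_subset _ _

/-! ## §2. Small blocks inside big blocks; vanishing of `B` on inner bonds of free small blocks and of empty big positions -/

/-- `n ∣ corner_{nL}(x)_i`. [folklore] -/
private theorem dvd_corner_big (x : Fin d → ℤ) (i : Fin d) : (n : ℤ) ∣ corner (n * L) x i := by
  rw [corner_apply]; push_cast; exact ⟨(L : ℤ) * (x i / ((n : ℤ) * L)), by ring⟩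

/-- `nL ∣ corner_{nL}(x)_i`. [folklore] -/
private theorem dvd_corner_big' (x : Fin d → ℤ) (i : Fin d) : ((n * L : ℕ) : ℤ) ∣ corner (n * L) x i := by
  rw [corner_apply]; exact dvd_mul_right _ _

/-- a small block (corner `y ∈ nℤᵈ`) lies inside the big block of its big corner: `B_n(y) ⊆ B_{nL}(corner_{nL} y)`. [cite: Balaban1984PropagatorsII, (2.89) p.239; folklore] -/
theorem small_block_subset_big (hn : 1 ≤ n) (hL : 1 ≤ L) {y : Fin d → ℤ} (hy : ∀ i, (n : ℤ) ∣ y i) :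
    block n y ⊆ block (n * L) (corner (n * L) y) := by
  have hN : 0 < n * L := Nat.mul_pos hn hL
  have hs : y ∈ subCorners n L (corner (n * L) y) := by
    have h := corner_mem_subCorners (n := n) (L := L) (mem_block_corner hN y)
    rwa [corner_eq_self_of_dvd y hy] at h
  exact block_sub_subset hn (fun i => dvd_corner_big y i) hs

/-- … hence a point of a small block has the big corner of the small corner. [cite: Balaban1984PropagatorsII, (2.89) p.239; folklore] -/
theorem corner_big_eq_of_mem_small (hn : 1 ≤ n) (hL : 1 ≤ L) {y x : Fin d → ℤ} (hy : ∀ i, (n : ℤ) ∣ y i) (hx : x ∈ block n y) :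
    corner (n * L) x = corner (n * L) y :=
  corner_eq_of_mem_block (Nat.mul_pos hn hL) (small_block_subset_big hn hL hy hx)

/-- a sub-corner of the `nL`-position `Y₀ ∈ (nL)ℤᵈ` has big corner `Y₀`. [cite: Balaban1984PropagatorsII, (2.89) p.239; folklore] -/
theorem corner_big_of_mem_subCorners (hn : 1 ≤ n) (hL : 1 ≤ L) {Y₀ s : Fin d → ℤ} (hY : ∀ i, ((n * L : ℕ) : ℤ) ∣ Y₀ i)
    (hs : s ∈ subCorners n L Y₀) : corner (n * L) s = Y₀ := by
  have hN : 0 < n * L := Nat.mul_pos hn hL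
  have hYn : ∀ i, (n : ℤ) ∣ Y₀ i := fun i => (dvd_mul_right (n : ℤ) (L : ℤ)).trans (by have h := hY i; push_cast at h; exact h)
  have h1 : s ∈ block (n * L) Y₀ := by
    obtain ⟨z, hz, rfl⟩ := mem_subCorners_iff.1 hs
    have h := mem_block_corner hn (corner n z)
    rw [corner_corner hn] at h
    exact block_sub_subset hn hYn hs h
  have e := corner_eq_self_of_dvd Y₀ hY
  rw [← e] at h1
  rw [corner_eq_of_mem_block hN h1, e]

/-- a point of the `nL`-position `Y₀` has its small corner among the sub-corners. [folklore] -/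
private theorem corner_small_mem_subCorners {Y₀ x : Fin d → ℤ} (hx : x ∈ block (n * L) Y₀) : corner n x ∈ subCorners n L Y₀ :=
  corner_mem_subCorners hx

/-- ★ **`B` vanishes on the inner bonds of a FREE small block**: a block `B_n(y)`, `y ∈ nℤᵈ ∖ Λs`, not inside a big block of `Λb` carries no bond of the two
regions. [cite: Balaban1984PropagatorsII, Lemma 2.4 p.245 («B = 0 outside Λ»); folklore] -/
theorem eq_zero_of_innerBonds_small (hn : 1 ≤ n) (hL : 1 ≤ L) {Λs Λb : Finset (Fin d → ℤ)} (hΛs : ∀ y ∈ Λs, ∀ i, (n : ℤ) ∣ y i)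
    (hΛb : ∀ Y ∈ Λb, ∀ i, ((n * L : ℕ) : ℤ) ∣ Y i) {B : Cfg d} (hB0 : ∀ b, b ∉ bonds₂ n L Λs Λb → B b = 0)
    {y : Fin d → ℤ} (hy : y ∉ Λs) (hyn : ∀ i, (n : ℤ) ∣ y i) (hyb : corner (n * L) y ∉ Λb)
    {b : (Fin d → ℤ) × Fin d} (hb : b ∈ innerBonds n y) : B b = 0 := by
  have hN : 0 < n * L := Nat.mul_pos hn hL
  refine hB0 b fun h => ?_
  rcases mem_union.1 h with h | h
  · exact innerBonds_not_mem_lamBonds hn hΛs hy hyn hb h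
  · obtain ⟨h1, h2⟩ := mem_innerBonds_iff.1 hb
    have hsub := small_block_subset_big hn hL hyn
    rcases mem_lamBonds.1 h with h | h
    · obtain ⟨Y, hY, hxY⟩ := mem_lam.1 h
      exact hyb (by rw [eq_of_mem_block hN (dvd_corner_big' y) (hΛb Y hY) (hsub h1) hxY]; exact hY)
    · obtain ⟨Y, hY, hxY⟩ := mem_lam.1 h
      exact hyb (by rw [eq_of_mem_block hN (dvd_corner_big' y) (hΛb Y hY) (hsub h2) hxY]; exact hY)

/-- ★ **`B` vanishes on the inner bonds of an EMPTY big position**: `Y ∈ (nL)ℤᵈ ∖ Λb` none of whose sub-corners is in `Λs`.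
[cite: Balaban1984PropagatorsII, Lemma 2.4 p.245 («B = 0 outside Λ»); folklore] -/
theorem eq_zero_of_innerBonds_bigEmpty (hn : 1 ≤ n) (hL : 1 ≤ L) {Λs Λb : Finset (Fin d → ℤ)} (hΛs : ∀ y ∈ Λs, ∀ i, (n : ℤ) ∣ y i)
    (hΛb : ∀ Y ∈ Λb, ∀ i, ((n * L : ℕ) : ℤ) ∣ Y i) {B : Cfg d} (hB0 : ∀ b, b ∉ bonds₂ n L Λs Λb → B b = 0)
    {Y : Fin d → ℤ} (hY : Y ∉ Λb) (hYN : ∀ i, ((n * L : ℕ) : ℤ) ∣ Y i) (hE : Disjoint (subCorners n L Y) Λs)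
    {b : (Fin d → ℤ) × Fin d} (hb : b ∈ innerBonds (n * L) Y) : B b = 0 := by
  have hN : 0 < n * L := Nat.mul_pos hn hL
  refine hB0 b fun h => ?_
  rcases mem_union.1 h with h | h
  · obtain ⟨h1, h2⟩ := mem_innerBonds_iff.1 hb
    -- an end point in a small block `B_n(y)`, `y ∈ Λs`, would put `y` among the sub-corners of `Y`
    have key : ∀ w, w ∈ block (n * L) Y → w ∈ lam n Λs → False := by
      intro w hwY hw
      obtain ⟨y, hy, hwy⟩ := mem_lam.1 hw
      have hc : corner n w = y := by
        rw [← corner_eq_self_of_dvd y (hΛs y hy)] at hwy ⊢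
        exact corner_eq_of_mem_block hn hwy
      exact disjoint_left.1 hE (hc ▸ corner_small_mem_subCorners hwY) hy
    rcases mem_lamBonds.1 h with h | h
    · exact key _ h1 h
    · exact key _ h2 h
  · exact innerBonds_not_mem_lamBonds hN hΛb hY hYN hb h

/-! ## §3. Coverage: every bond of the two regions is inside a small block, inside a big block, or crosses a small face of `idxS` or a big face -/

/-- the step INTO a block from outside: `x ∉ B_N(Y)`, `x + e_ν ∈ B_N(Y)` ⇒ `x` lies in the last layer of `B_N(Y − N e_ν)` in direction `ν`. [folklore] -/
private theorem mem_lastLayer_sub_of_step {N : ℕ} {Y x : Fin d → ℤ} {ν : Fin d} (h1 : x ∉ block N Y) (h2 : x + unitVec ν ∈ block N Y) :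
    x ∈ lastLayer N (Y - (N : ℤ) • unitVec ν) ν := by
  have hb2 := mem_block.1 h2
  have hco : x ν + 1 = Y ν := by
    have hν := hb2 ν
    rw [add_unitVec_apply, if_pos rfl] at hν
    by_contra hne
    apply h1
    refine mem_block.2 fun i => ?_
    have hi := hb2 i
    rw [add_unitVec_apply] at hi
    by_cases hib : i = ν
    · rw [hib]; omega
    · rw [if_neg hib, add_zero] at hi; exact hi
  refine mem_lastLayer.2 ⟨mem_block.2 fun i => ?_, ?_⟩
  · have hi := hb2 i
    rw [add_unitVec_apply] at hi
    rw [sub_smul_unitVec_apply]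
    by_cases hib : i = ν
    · rw [if_pos hib, hib]; rw [hib, if_pos rfl] at hi; omega
    · rw [if_neg hib, add_zero] at hi; rw [if_neg hib]; omega
  · rw [sub_smul_unitVec_apply, if_pos rfl]; omega

/-- a bond `⟨x, x + e_ν⟩` with `x` in the last layer of `B_N(y)` in direction `ν` is a crossing bond of the face `(y, ν)`. [folklore] -/
private theorem mem_faceImage {N : ℕ} {y : Fin d → ℤ} {b : (Fin d → ℤ) × Fin d} (h : b.1 ∈ lastLayer N y b.2) :
    b ∈ (lastLayer N y b.2).image fun x => (x, b.2) := mem_image.2 ⟨b.1, h, rfl⟩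

/-- not inside the block but starting in it ⇒ starting in its last layer. [folklore] -/
private theorem mem_lastLayer_of_not_inner {N : ℕ} {y : Fin d → ℤ} {b : (Fin d → ℤ) × Fin d} (h1 : b.1 ∈ block N y) (h2 : b ∉ innerBonds N y) :
    b.1 ∈ lastLayer N y b.2 := by
  have hb := (mem_block.1 h1 b.2).2
  have h3 : ¬ b.1 b.2 + 1 < y b.2 + N := fun h => h2 (mem_innerBonds.2 ⟨h1, h⟩)
  exact mem_lastLayer.2 ⟨h1, by omega⟩

/-- ★★ **TWO-SCALE COVERAGE.**  `‖B‖²_E − N_in^S − N_in^B ≤` (small crossings over `idxS`) `+` (big crossings over the coarse `nL`-bonds meeting `Λb`): a bond of the two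
regions not inside a block of `Λs` or of `Λb` crosses a small face between blocks not inside big blocks, or a big face (incl. the INTERFACE small∕big, read at scale
`nL`).  Regions disjoint (`corner_{nL} y ∉ Λb` for `y ∈ Λs`); no admissibility needed. [cite: Balaban1984PropagatorsII, (2.89) p.239, (2.124)–(2.128) p.245] -/
theorem crossing_cover₂ (hn : 1 ≤ n) (hL : 1 ≤ L) {Λs Λb : Finset (Fin d → ℤ)} (hΛs : ∀ y ∈ Λs, ∀ i, (n : ℤ) ∣ y i)
    (hΛb : ∀ Y ∈ Λb, ∀ i, ((n * L : ℕ) : ℤ) ∣ Y i) (hdisj : ∀ y ∈ Λs, corner (n * L) y ∉ Λb) (B : Cfg d) :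
    normSq₂ n L Λs Λb B - nIn n Λs B - nIn (n * L) Λb B ≤ crossS n L Λs Λb B + crossB n L Λb B := by
  classical
  have hN : 0 < n * L := Nat.mul_pos hn hL
  set US := Λs.biUnion (innerBonds n) with hUS
  set UB := Λb.biUnion (innerBonds (n * L)) with hUB
  set FS := (idxS n L Λs Λb).biUnion fun c => (lastLayer n c.1 c.2).image fun x => (x, c.2) with hFS
  set FB := (coarseBonds (n * L) Λb).biUnion fun C => (lastLayer (n * L) C.1 C.2).image fun x => (x, C.2) with hFB
  have hUSsub : US ⊆ bonds₂ n L Λs Λb := fun b hb => by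
    obtain ⟨y, hy, hby⟩ := mem_biUnion.1 hb
    exact mem_union_left _ (mem_lamBonds.2 (Or.inl (mem_lam.2 ⟨y, hy, (mem_innerBonds.1 hby).1⟩)))
  have hUBsub : UB ⊆ bonds₂ n L Λs Λb := fun b hb => by
    obtain ⟨Y, hY, hbY⟩ := mem_biUnion.1 hb
    exact mem_union_right _ (mem_lamBonds.2 (Or.inl (mem_lam.2 ⟨Y, hY, (mem_innerBonds.1 hbY).1⟩)))
  have hUdisj : Disjoint US UB := by
    refine disjoint_left.2 fun b hbS hbB => ?_
    obtain ⟨y, hy, hby⟩ := mem_biUnion.1 hbS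
    obtain ⟨Y, hY, hbY⟩ := mem_biUnion.1 hbB
    have h1 := small_block_subset_big hn hL (hΛs y hy) (mem_innerBonds.1 hby).1
    have h2 := (mem_innerBonds.1 hbY).1
    exact hdisj y hy (by rw [eq_of_mem_block hN (dvd_corner_big' y) (hΛb Y hY) h1 h2]; exact hY)
  have hnS : nIn n Λs B = ∑ b ∈ US, B b ^ 2 := by rw [nIn, sum_biUnion (pairwiseDisjoint_innerBonds hn hΛs)]
  have hnB : nIn (n * L) Λb B = ∑ b ∈ UB, B b ^ 2 := by rw [nIn, sum_biUnion (pairwiseDisjoint_innerBonds hN hΛb)]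
  have hsd : normSq₂ n L Λs Λb B - nIn n Λs B - nIn (n * L) Λb B = ∑ b ∈ bonds₂ n L Λs Λb \ (US ∪ UB), B b ^ 2 := by
    rw [hnS, hnB, normSq₂, ← sum_sdiff (union_subset hUSsub hUBsub), sum_union hUdisj]
    ring
  have hFSle : ∑ b ∈ FS, B b ^ 2 ≤ crossS n L Λs Λb B := by
    refine (sum_biUnion_le_of_nonneg _ _ fun _ => sq_nonneg _).trans (le_of_eq (sum_congr rfl fun c _ => ?_))
    rw [sum_image fun x _ x' _ h => by simpa using congr_arg Prod.fst h]
  have hFBle : ∑ b ∈ FB, B b ^ 2 ≤ crossB n L Λb B := by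
    refine (sum_biUnion_le_of_nonneg _ _ fun _ => sq_nonneg _).trans (le_of_eq (sum_congr rfl fun c _ => ?_))
    rw [sum_image fun x _ x' _ h => by simpa using congr_arg Prod.fst h]
  rw [hsd]
  refine (sum_le_sum_add_sum_of_subset_union (A := FS) (B := FB) (fun b hb => ?_) fun _ => sq_nonneg _).trans (add_le_add hFSle hFBle)
  -- the coverage proper
  obtain ⟨hbE, hbU⟩ := mem_sdiff.1 hb
  have hnotS : ∀ y ∈ Λs, b ∉ innerBonds n y := fun y hy h => hbU (mem_union_left _ (mem_biUnion.2 ⟨y, hy, h⟩))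
  have hnotB : ∀ Y ∈ Λb, b ∉ innerBonds (n * L) Y := fun Y hY h => hbU (mem_union_right _ (mem_biUnion.2 ⟨Y, hY, h⟩))
  -- the big face entered from outside a big block `Y ∈ Λb`
  have stepB : ∀ Y ∈ Λb, b.1 ∉ block (n * L) Y → b.1 + unitVec b.2 ∈ block (n * L) Y → b ∈ FS ∪ FB := by
    intro Y hY h1 h2
    refine mem_union_right _ (mem_biUnion.2 ⟨(Y - ((n * L : ℕ) : ℤ) • unitVec b.2, b.2), mem_coarseBonds.2 (Or.inr ?_),
      mem_faceImage (mem_lastLayer_sub_of_step h1 h2)⟩)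
    dsimp only; rw [sub_add_cancel]; exact hY
  by_cases hA : b.1 ∈ lam (n * L) Λb
  · -- Case A: the bond starts in a big block: it leaves it through the last layer
    obtain ⟨Y, hY, hxY⟩ := mem_lam.1 hA
    exact mem_union_right _ (mem_biUnion.2 ⟨(Y, b.2), mem_coarseBonds.2 (Or.inl hY), mem_faceImage (mem_lastLayer_of_not_inner hxY (hnotB Y hY))⟩)
  · by_cases hBc : b.1 ∈ lam n Λs
    · -- Case B: the bond starts in a small block `y ∈ Λs` and leaves it
      obtain ⟨y, hy, hxy⟩ := mem_lam.1 hBc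
      have hlast := mem_lastLayer_of_not_inner hxy (hnotS y hy)
      by_cases hB2 : corner (n * L) (y + (n : ℤ) • unitVec b.2) ∈ Λb
      · -- … into a big block: the INTERFACE, read at scale `nL`
        refine stepB _ hB2 (fun h => hA (mem_lam.2 ⟨_, hB2, h⟩)) ?_
        have hyn' : ∀ i, (n : ℤ) ∣ (y + (n : ℤ) • unitVec b.2) i := fun i => by
          rw [add_smul_unitVec_apply]; exact dvd_add (hΛs y hy i) (by split_ifs <;> simp)
        exact small_block_subset_big hn hL hyn' (firstLayer_subset_block y b.2 ((add_unitVec_mem_firstLayer hn).2 hlast))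
      · -- … into a block not inside a big block: a small index
        exact mem_union_left _ (mem_biUnion.2 ⟨(y, b.2), mem_idxS.2 ⟨mem_coarseBonds.2 (Or.inl hy), hdisj y hy, hB2⟩, mem_faceImage hlast⟩)
    · -- Case C: the bond starts outside both regions and steps into one of them
      rcases mem_union.1 hbE with h | h <;> rcases mem_lamBonds.1 h with h | h
      · exact absurd h hBc
      · -- into a small block `y' ∈ Λs`
        obtain ⟨y', hy', hxy'⟩ := mem_lam.1 h
        have h1 : b.1 ∉ block n y' := fun h' => hBc (mem_lam.2 ⟨y', hy', h'⟩)
        have hlast := mem_lastLayer_sub_of_step h1 hxy'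
        have hyn' : ∀ i, (n : ℤ) ∣ (y' - (n : ℤ) • unitVec b.2) i := fun i => by
          rw [sub_smul_unitVec_apply]; exact dvd_sub (hΛs y' hy' i) (by split_ifs <;> simp)
        refine mem_union_left _ (mem_biUnion.2 ⟨(y' - (n : ℤ) • unitVec b.2, b.2), mem_idxS.2 ⟨mem_coarseBonds.2 (Or.inr ?_), ?_, ?_⟩,
          mem_faceImage hlast⟩)
        · dsimp only; rw [sub_add_cancel]; exact hy'
        · intro hYb
          exact hA (mem_lam.2 ⟨_, hYb, small_block_subset_big hn hL hyn' (lastLayer_subset_block _ _ hlast)⟩)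
        · dsimp only; rw [sub_add_cancel]; exact hdisj y' hy'
      · exact absurd h hA
      · -- into a big block `Y ∈ Λb`
        obtain ⟨Y, hY, hxY⟩ := mem_lam.1 h
        exact stepB Y hY (fun h' => hA (mem_lam.2 ⟨Y, hY, h'⟩)) hxY

/-! ## §4. The small faces (indices of `idxS`): pv09's per-face split at scale `n`, and the absorption of its right side -/

/-- **the per-face split (pv09 `face_split`, gauge-free) summed over the small indices.** [cite: Balaban1984PropagatorsII, (2.124)–(2.127) p.245] -/
theorem sum_face_split_idxS (hd : 2 ≤ d) (hn : 1 ≤ n) {κ : ℝ} (hκ : 0 < κ) (hLI : LayerIneq d n κ) (Λs Λb : Finset (Fin d → ℤ)) (B : Cfg d) :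
    ((n : ℝ)⁻¹) ^ (d + 1) * crossS n L Λs Λb B ≤
      3 * ∑ c ∈ idxS n L Λs Λb, q1Term n B c +
      3 * ((n : ℝ)⁻¹) ^ d *
        (∑ c ∈ idxS n L Λs Λb, ∑ b ∈ innerBonds n c.1, B b ^ 2 +
          ∑ c ∈ idxS n L Λs Λb, ∑ b ∈ innerBonds n (c.1 + (n : ℤ) • unitVec c.2), B b ^ 2) +
      3 / κ * ((n : ℝ)⁻¹) ^ d *
        (∑ c ∈ idxS n L Λs Λb, ∑ b ∈ bondsIn (lastLayer n c.1 c.2), curl B b.1 b.2 c.2 ^ 2 +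
          ∑ c ∈ idxS n L Λs Λb, ∑ b ∈ bondsIn (lastLayer n c.1 c.2), B b ^ 2 +
          ∑ c ∈ idxS n L Λs Λb, ∑ b ∈ bondsIn (firstLayer n c.1 c.2), B b ^ 2) := by
  have h := sum_le_sum fun c (_ : c ∈ idxS n L Λs Λb) => face_split hd hn hκ hLI c.1 c.2 B
  rw [crossS]
  refine le_trans (le_of_eq (mul_sum _ _ _)) (h.trans (le_of_eq ?_))
  simp only [sum_add_distrib, ← mul_sum, Prod.mk.eta]

/-- block-term count at scale `n` over any set of pairs `(y, μ)`, `y ∈ nℤᵈ` with `B_n(y)` not inside a big block: `Σ Σ_{b ⊂ B_n(y)} B² ≤ d·N_in^S` (blocks of `Λs` occur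
for at most `d` directions, the other blocks carry `B = 0` by `eq_zero_of_innerBonds_small`). [cite: Balaban1984PropagatorsII, (2.125)–(2.127) p.245; folklore] -/
theorem sum_blockSq_le₂ (hn : 1 ≤ n) (hL : 1 ≤ L) {Λs Λb : Finset (Fin d → ℤ)} (hΛs : ∀ y ∈ Λs, ∀ i, (n : ℤ) ∣ y i)
    (hΛb : ∀ Y ∈ Λb, ∀ i, ((n * L : ℕ) : ℤ) ∣ Y i) {B : Cfg d} (hB0 : ∀ b, b ∉ bonds₂ n L Λs Λb → B b = 0)
    (S : Finset ((Fin d → ℤ) × Fin d)) (hS : ∀ c ∈ S, (∀ i, (n : ℤ) ∣ c.1 i) ∧ corner (n * L) c.1 ∉ Λb) :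
    ∑ c ∈ S, ∑ b ∈ innerBonds n c.1, B b ^ 2 ≤ (d : ℝ) * nIn n Λs B := by
  classical
  rw [← sum_filter_add_sum_filter_not S (fun c => c.1 ∈ Λs)]
  have h0 : ∑ c ∈ S.filter (fun c => ¬ c.1 ∈ Λs), ∑ b ∈ innerBonds n c.1, B b ^ 2 = 0 := by
    refine sum_eq_zero fun c hc => sum_eq_zero fun b hb => ?_
    obtain ⟨hcS, hc⟩ := mem_filter.1 hc
    rw [eq_zero_of_innerBonds_small hn hL hΛs hΛb hB0 hc (hS c hcS).1 (hS c hcS).2 hb]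
    ring
  rw [h0, add_zero]
  calc ∑ c ∈ S.filter (fun c => c.1 ∈ Λs), ∑ b ∈ innerBonds n c.1, B b ^ 2
      ≤ ∑ c ∈ Λs ×ˢ (univ : Finset (Fin d)), ∑ b ∈ innerBonds n c.1, B b ^ 2 :=
        sum_le_sum_of_subset_of_nonneg (fun c hc => mem_product.2 ⟨(mem_filter.1 hc).2, mem_univ _⟩)
          fun _ _ _ => sum_nonneg fun _ _ => sq_nonneg _
    _ = (d : ℝ) * nIn n Λs B := by
        rw [sum_product, nIn, mul_sum]
        refine sum_congr rfl fun y _ => ?_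
        dsimp only
        rw [sum_const, card_univ, Fintype.card_fin, nsmul_eq_mul]

/-- the `c₋`-count over the small indices: `Σ_{c ∈ idxS} Σ_{b ⊂ B_n(c₋)} B² ≤ d·N_in^S`. [cite: Balaban1984PropagatorsII, (2.125)–(2.127) p.245; folklore] -/
theorem sum_blockSq_idxS_minus_le (hn : 1 ≤ n) (hL : 1 ≤ L) {Λs Λb : Finset (Fin d → ℤ)} (hΛs : ∀ y ∈ Λs, ∀ i, (n : ℤ) ∣ y i)
    (hΛb : ∀ Y ∈ Λb, ∀ i, ((n * L : ℕ) : ℤ) ∣ Y i) {B : Cfg d} (hB0 : ∀ b, b ∉ bonds₂ n L Λs Λb → B b = 0) :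
    ∑ c ∈ idxS n L Λs Λb, ∑ b ∈ innerBonds n c.1, B b ^ 2 ≤ (d : ℝ) * nIn n Λs B :=
  sum_blockSq_le₂ hn hL hΛs hΛb hB0 _ fun _ hc => ⟨dvd_of_mem_coarseBonds hΛs (idxS_subset _ _ hc), (mem_idxS.1 hc).2.1⟩

/-- the `c₊`-count over the small indices: `Σ_{c ∈ idxS} Σ_{b ⊂ B_n(c₊)} B² ≤ d·N_in^S`. [cite: Balaban1984PropagatorsII, (2.125)–(2.127) p.245; folklore] -/
theorem sum_blockSq_idxS_plus_le (hn : 1 ≤ n) (hL : 1 ≤ L) {Λs Λb : Finset (Fin d → ℤ)} (hΛs : ∀ y ∈ Λs, ∀ i, (n : ℤ) ∣ y i)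
    (hΛb : ∀ Y ∈ Λb, ∀ i, ((n * L : ℕ) : ℤ) ∣ Y i) {B : Cfg d} (hB0 : ∀ b, b ∉ bonds₂ n L Λs Λb → B b = 0) :
    ∑ c ∈ idxS n L Λs Λb, ∑ b ∈ innerBonds n (c.1 + (n : ℤ) • unitVec c.2), B b ^ 2 ≤ (d : ℝ) * nIn n Λs B := by
  classical
  have hinj : Set.InjOn (fun c : (Fin d → ℤ) × Fin d => (c.1 + (n : ℤ) • unitVec c.2, c.2)) ↑(idxS n L Λs Λb) :=
    fun c _ c' _ h => by
      simp only [Prod.mk.injEq] at h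
      obtain ⟨h1, h2⟩ := h
      rw [h2] at h1
      exact Prod.ext (add_right_cancel h1) h2
  rw [← sum_image (f := fun c : (Fin d → ℤ) × Fin d => ∑ b ∈ innerBonds n c.1, B b ^ 2) hinj]
  refine sum_blockSq_le₂ hn hL hΛs hΛb hB0 _ fun c hc => ?_
  obtain ⟨c', hc', rfl⟩ := mem_image.1 hc
  refine ⟨fun i => ?_, (mem_idxS.1 hc').2.2⟩
  dsimp only
  rw [add_smul_unitVec_apply]
  exact dvd_add (dvd_of_mem_coarseBonds hΛs (idxS_subset _ _ hc') i) (by split_ifs <;> simp)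

/-- per small index, the tangential layer `Σ_{b ⊂ Δ′_n(c)} B²` is controlled by the tree gauge of `B_n(c₋)` (pv09 `layer_sq_le`) if `c₋ ∈ Λs`, and vanishes otherwise.
[cite: Balaban1984PropagatorsII, (2.124), (2.126)–(2.127) p.245; folklore] -/
theorem layerLast_idxS_le (hn : 1 ≤ n) (hL : 1 ≤ L) {Λs Λb : Finset (Fin d → ℤ)} (hΛs : ∀ y ∈ Λs, ∀ i, (n : ℤ) ∣ y i)
    (hΛb : ∀ Y ∈ Λb, ∀ i, ((n * L : ℕ) : ℤ) ∣ Y i) {B : Cfg d} (hB0 : ∀ b, b ∉ bonds₂ n L Λs Λb → B b = 0)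
    (hTs : ∀ y ∈ Λs, ∀ b ∈ treeBonds n y, B b = 0) {c : (Fin d → ℤ) × Fin d} (hc : c ∈ idxS n L Λs Λb) :
    ∑ b ∈ bondsIn (lastLayer n c.1 c.2), B b ^ 2 ≤
      ((d : ℝ) - 1) * ((n : ℝ) - 1) * (n : ℝ) ^ (d - 2) * (if c.1 ∈ Λs then ∑ p ∈ innerPlaq n c.1, curl B p.1 p.2.1 p.2.2 ^ 2 else 0) := by
  classical
  split_ifs with h1
  · exact (sum_le_sum_of_subset_of_nonneg (bondsIn_lastLayer_subset c.1 c.2) fun _ _ _ => sq_nonneg _).trans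
      (layer_sq_le hn c.1 c.2 _ B (hTs c.1 h1))
  · rw [mul_zero]
    refine (sum_eq_zero fun b hb => ?_).le
    have hbi : b ∈ innerBonds n c.1 := (mem_filter.1 (bondsIn_lastLayer_subset c.1 c.2 hb)).1
    rw [eq_zero_of_innerBonds_small hn hL hΛs hΛb hB0 h1 (dvd_of_mem_coarseBonds hΛs (idxS_subset _ _ hc)) (mem_idxS.1 hc).2.1 hbi]
    ring

/-- the same for the first layer `Δ″_n(c) ⊂ B_n(c₊)`. [cite: Balaban1984PropagatorsII, (2.124), (2.126)–(2.127) p.245; folklore] -/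
theorem layerFirst_idxS_le (hn : 1 ≤ n) (hL : 1 ≤ L) {Λs Λb : Finset (Fin d → ℤ)} (hΛs : ∀ y ∈ Λs, ∀ i, (n : ℤ) ∣ y i)
    (hΛb : ∀ Y ∈ Λb, ∀ i, ((n * L : ℕ) : ℤ) ∣ Y i) {B : Cfg d} (hB0 : ∀ b, b ∉ bonds₂ n L Λs Λb → B b = 0)
    (hTs : ∀ y ∈ Λs, ∀ b ∈ treeBonds n y, B b = 0) {c : (Fin d → ℤ) × Fin d} (hc : c ∈ idxS n L Λs Λb) :
    ∑ b ∈ bondsIn (firstLayer n c.1 c.2), B b ^ 2 ≤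
      ((d : ℝ) - 1) * ((n : ℝ) - 1) * (n : ℝ) ^ (d - 2) *
        (if c.1 + (n : ℤ) • unitVec c.2 ∈ Λs then ∑ p ∈ innerPlaq n (c.1 + (n : ℤ) • unitVec c.2), curl B p.1 p.2.1 p.2.2 ^ 2 else 0) := by
  classical
  have hdvd : ∀ i, (n : ℤ) ∣ (c.1 + (n : ℤ) • unitVec c.2) i := fun i => by
    rw [add_smul_unitVec_apply]; exact dvd_add (dvd_of_mem_coarseBonds hΛs (idxS_subset _ _ hc) i) (by split_ifs <;> simp)
  split_ifs with h1
  · exact (sum_le_sum_of_subset_of_nonneg (bondsIn_firstLayer_subset c.1 c.2) fun _ _ _ => sq_nonneg _).trans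
      (layer_sq_le hn _ c.2 _ B (hTs _ h1))
  · rw [mul_zero]
    refine (sum_eq_zero fun b hb => ?_).le
    have hbi : b ∈ innerBonds n (c.1 + (n : ℤ) • unitVec c.2) := (mem_filter.1 (bondsIn_firstLayer_subset c.1 c.2 hb)).1
    rw [eq_zero_of_innerBonds_small hn hL hΛs hΛb hB0 h1 hdvd (mem_idxS.1 hc).2.2 hbi]
    ring

/-- **the last tangential layers over the small indices: `Σ_{c ∈ idxS} Σ_{b ⊂ Δ′_n(c)} B² ≤ (d−1)(n−1)n^{d−2}·d·P_in^S`.**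
[cite: Balaban1984PropagatorsII, (2.124), (2.126)–(2.127) p.245; folklore] -/
theorem sum_layerLast_idxS_le (hd : 1 ≤ d) (hn : 1 ≤ n) (hL : 1 ≤ L) {Λs Λb : Finset (Fin d → ℤ)} (hΛs : ∀ y ∈ Λs, ∀ i, (n : ℤ) ∣ y i)
    (hΛb : ∀ Y ∈ Λb, ∀ i, ((n * L : ℕ) : ℤ) ∣ Y i) {B : Cfg d} (hB0 : ∀ b, b ∉ bonds₂ n L Λs Λb → B b = 0)
    (hTs : ∀ y ∈ Λs, ∀ b ∈ treeBonds n y, B b = 0) :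
    ∑ c ∈ idxS n L Λs Λb, ∑ b ∈ bondsIn (lastLayer n c.1 c.2), B b ^ 2 ≤
      ((d : ℝ) - 1) * ((n : ℝ) - 1) * (n : ℝ) ^ (d - 2) * ((d : ℝ) * pIn n Λs B) := by
  classical
  refine (sum_le_sum fun c hc => layerLast_idxS_le hn hL hΛs hΛb hB0 hTs hc).trans ?_
  rw [← mul_sum]
  exact mul_le_mul_of_nonneg_left (sum_ite_blockPlaq_le Λs B _) (layerCoeff_nonneg hd hn)

/-- **the first tangential layers over the small indices: `Σ_{c ∈ idxS} Σ_{b ⊂ Δ″_n(c)} B² ≤ (d−1)(n−1)n^{d−2}·d·P_in^S`.**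
[cite: Balaban1984PropagatorsII, (2.124), (2.126)–(2.127) p.245; folklore] -/
theorem sum_layerFirst_idxS_le (hd : 1 ≤ d) (hn : 1 ≤ n) (hL : 1 ≤ L) {Λs Λb : Finset (Fin d → ℤ)} (hΛs : ∀ y ∈ Λs, ∀ i, (n : ℤ) ∣ y i)
    (hΛb : ∀ Y ∈ Λb, ∀ i, ((n * L : ℕ) : ℤ) ∣ Y i) {B : Cfg d} (hB0 : ∀ b, b ∉ bonds₂ n L Λs Λb → B b = 0)
    (hTs : ∀ y ∈ Λs, ∀ b ∈ treeBonds n y, B b = 0) :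
    ∑ c ∈ idxS n L Λs Λb, ∑ b ∈ bondsIn (firstLayer n c.1 c.2), B b ^ 2 ≤
      ((d : ℝ) - 1) * ((n : ℝ) - 1) * (n : ℝ) ^ (d - 2) * ((d : ℝ) * pIn n Λs B) := by
  classical
  refine (sum_le_sum fun c hc => layerFirst_idxS_le hn hL hΛs hΛb hB0 hTs hc).trans ?_
  rw [← mul_sum]
  refine mul_le_mul_of_nonneg_left ?_ (layerCoeff_nonneg hd hn)
  have hinj : Set.InjOn (fun c : (Fin d → ℤ) × Fin d => (c.1 + (n : ℤ) • unitVec c.2, c.2)) ↑(idxS n L Λs Λb) :=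
    fun c _ c' _ h => by
      simp only [Prod.mk.injEq] at h
      obtain ⟨h1, h2⟩ := h
      rw [h2] at h1
      exact Prod.ext (add_right_cancel h1) h2
  have e : ∑ c ∈ idxS n L Λs Λb, (if c.1 + (n : ℤ) • unitVec c.2 ∈ Λs then
        ∑ p ∈ innerPlaq n (c.1 + (n : ℤ) • unitVec c.2), curl B p.1 p.2.1 p.2.2 ^ 2 else 0) =
      ∑ c ∈ (idxS n L Λs Λb).image (fun c => (c.1 + (n : ℤ) • unitVec c.2, c.2)),
        (if c.1 ∈ Λs then ∑ p ∈ innerPlaq n c.1, curl B p.1 p.2.1 p.2.2 ^ 2 else 0) := by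
    rw [sum_image hinj]
  rw [e]
  exact sum_ite_blockPlaq_le Λs B _

/-- **the small-face plaquettes over the small indices are among `P_cr^S`: `Σ_{c ∈ idxS} Σ_{b ⊂ Δ′_n(c)} |(∂₁B)(p(b))|² ≤ d1Sq n Λs B − P_in^S`** (pv09 `faces_le_pCr`
over the larger family of all small coarse bonds). [cite: Balaban1984PropagatorsII, (2.124)+(2.128) p.245; folklore] -/
theorem faces_idxS_le (hn : 1 ≤ n) {Λs : Finset (Fin d → ℤ)} (hΛs : ∀ y ∈ Λs, ∀ i, (n : ℤ) ∣ y i) (Λb : Finset (Fin d → ℤ)) (B : Cfg d) :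
    ∑ c ∈ idxS n L Λs Λb, ∑ b ∈ bondsIn (lastLayer n c.1 c.2), curl B b.1 b.2 c.2 ^ 2 ≤ d1Sq n Λs B - pIn n Λs B :=
  (sum_le_sum_of_subset_of_nonneg (idxS_subset Λs Λb) fun _ _ _ => sum_nonneg fun _ _ => sq_nonneg _).trans (faces_le_pCr hn hΛs B)

/-! ## §5. The big faces (the coarse `nL`-bonds meeting `Λb`): absorption of the right side of the scale-`nL` split by END TYPE (big block ∕ composite ∕ empty) -/

/-- the lower end `C₋` of a big coarse bond meeting `Λb` is admissible (it is in `Λb`, or it is the `nL`-neighbour `C₊ − nL e_μ` of `C₊ ∈ Λb`). [cite: Balaban1984PropagatorsII, (2.2) p.224, (2.89) p.239] -/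
theorem adm_fst {Λs Λb : Finset (Fin d → ℤ)}
    (hH : ∀ Y ∈ Λb, ∀ μ : Fin d, Adm n L Λs Λb (Y + ((n * L : ℕ) : ℤ) • unitVec μ) ∧ Adm n L Λs Λb (Y - ((n * L : ℕ) : ℤ) • unitVec μ))
    {C : (Fin d → ℤ) × Fin d} (hC : C ∈ coarseBonds (n * L) Λb) : Adm n L Λs Λb C.1 := by
  rcases mem_coarseBonds.1 hC with h | h
  · exact Or.inl h
  · have h2 := (hH _ h C.2).2
    rwa [add_sub_cancel_right] at h2

/-- the upper end `C₊` of a big coarse bond meeting `Λb` is admissible. [cite: Balaban1984PropagatorsII, (2.2) p.224, (2.89) p.239] -/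
theorem adm_snd {Λs Λb : Finset (Fin d → ℤ)}
    (hH : ∀ Y ∈ Λb, ∀ μ : Fin d, Adm n L Λs Λb (Y + ((n * L : ℕ) : ℤ) • unitVec μ) ∧ Adm n L Λs Λb (Y - ((n * L : ℕ) : ℤ) • unitVec μ))
    {C : (Fin d → ℤ) × Fin d} (hC : C ∈ coarseBonds (n * L) Λb) : Adm n L Λs Λb (C.1 + ((n * L : ℕ) : ℤ) • unitVec C.2) := by
  rcases mem_coarseBonds.1 hC with h | h
  · exact (hH _ h C.2).1
  · exact Or.inl h

/-- ★ **per admissible `nL`-position `Y`: `Σ_{b ⊂ B_{nL}(Y)} B² ≤ 1_{Y ∈ Λb}·(the same) + 1_{Y composite}·compG(Y)`** (big block: itself; composite: C6a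
`sum_innerBonds_big_le`; empty: `0`). [cite: Balaban1984PropagatorsII, (2.89) p.239, (2.125)–(2.127) p.245] -/
theorem inner_big_le (hn : 1 ≤ n) (hL : 1 ≤ L) {Λs Λb : Finset (Fin d → ℤ)} (hΛs : ∀ y ∈ Λs, ∀ i, (n : ℤ) ∣ y i)
    (hΛb : ∀ Y ∈ Λb, ∀ i, ((n * L : ℕ) : ℤ) ∣ Y i) {B : Cfg d} (hB0 : ∀ b, b ∉ bonds₂ n L Λs Λb → B b = 0)
    {Y : Fin d → ℤ} (hYN : ∀ i, ((n * L : ℕ) : ℤ) ∣ Y i) (hA : Adm n L Λs Λb Y) :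
    ∑ b ∈ innerBonds (n * L) Y, B b ^ 2 ≤
      (if Y ∈ Λb then ∑ b ∈ innerBonds (n * L) Y, B b ^ 2 else 0) + (if subCorners n L Y ⊆ Λs then compG n L B Y else 0) := by
  classical
  have hG : 0 ≤ (if subCorners n L Y ⊆ Λs then compG n L B Y else 0) := by
    split_ifs
    · exact compG_nonneg B Y
    · exact le_rfl
  by_cases h1 : Y ∈ Λb
  · rw [if_pos h1]; exact le_add_of_nonneg_right hG
  rw [if_neg h1, zero_add]
  rcases hA with h | h | h
  · exact absurd h h1
  · rw [if_pos h]; exact sum_innerBonds_big_le hn Y fun _ => sq_nonneg _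
  · rw [sum_eq_zero fun b hb => by rw [eq_zero_of_innerBonds_bigEmpty hn hL hΛs hΛb hB0 h1 hYN h hb]; ring]
    exact hG

/-- ★ **per big coarse bond, the last tangential layer**: `Σ_{b ⊂ Δ′_{nL}(C)} B² ≤ (d−1)(nL−1)(nL)^{d−2}·1_{C₋ ∈ Λb}·Σ_{p ⊂ B_{nL}(C₋)}|∂₁B|² + 1_{C₋ composite}·compG(C₋)`
(big block: pv09 `layer_sq_le` in the tree gauge of `B_{nL}(C₋)`; composite: C6a `sum_bondsIn_lastLayer_big_le`; empty: `0`).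
[cite: Balaban1984PropagatorsII, (2.124), (2.126)–(2.127) p.245, (2.89) p.239] -/
theorem layerLast_big_le (hn : 1 ≤ n) (hL : 1 ≤ L) {Λs Λb : Finset (Fin d → ℤ)} (hΛs : ∀ y ∈ Λs, ∀ i, (n : ℤ) ∣ y i)
    (hΛb : ∀ Y ∈ Λb, ∀ i, ((n * L : ℕ) : ℤ) ∣ Y i) {B : Cfg d} (hB0 : ∀ b, b ∉ bonds₂ n L Λs Λb → B b = 0)
    (hTb : ∀ Y ∈ Λb, ∀ b ∈ treeBonds (n * L) Y, B b = 0)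
    {C : (Fin d → ℤ) × Fin d} (hCN : ∀ i, ((n * L : ℕ) : ℤ) ∣ C.1 i) (hA : Adm n L Λs Λb C.1) :
    ∑ b ∈ bondsIn (lastLayer (n * L) C.1 C.2), B b ^ 2 ≤
      ((d : ℝ) - 1) * (((n * L : ℕ) : ℝ) - 1) * ((n * L : ℕ) : ℝ) ^ (d - 2) *
          (if C.1 ∈ Λb then ∑ p ∈ innerPlaq (n * L) C.1, curl B p.1 p.2.1 p.2.2 ^ 2 else 0) +
        (if subCorners n L C.1 ⊆ Λs then compG n L B C.1 else 0) := by
  classical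
  have hN : 1 ≤ n * L := Nat.mul_pos hn hL
  have hd1 : 1 ≤ d := Nat.succ_le_of_lt (lt_of_le_of_lt (Nat.zero_le _) C.2.2)
  have hG : 0 ≤ (if subCorners n L C.1 ⊆ Λs then compG n L B C.1 else 0) := by
    split_ifs
    · exact compG_nonneg B C.1
    · exact le_rfl
  by_cases h1 : C.1 ∈ Λb
  · rw [if_pos h1]
    exact ((sum_le_sum_of_subset_of_nonneg (bondsIn_lastLayer_subset C.1 C.2) fun _ _ _ => sq_nonneg _).trans
      (layer_sq_le hN C.1 C.2 _ B (hTb C.1 h1))).trans (le_add_of_nonneg_right hG)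
  rw [if_neg h1, mul_zero, zero_add]
  rcases hA with h | h | h
  · exact absurd h h1
  · rw [if_pos h]; exact sum_bondsIn_lastLayer_big_le hn C.1 C.2 fun _ => sq_nonneg _
  · rw [sum_eq_zero fun b hb => by
      rw [eq_zero_of_innerBonds_bigEmpty hn hL hΛs hΛb hB0 h1 hCN h (mem_filter.1 (bondsIn_lastLayer_subset C.1 C.2 hb)).1]; ring]
    exact hG

/-- ★ **per big coarse bond, the first tangential layer** `Δ″_{nL}(C) ⊂ B_{nL}(C₊)`: the same with `C₊` (C6a `sum_bondsIn_firstLayer_big_le` for a composite `C₊`).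
[cite: Balaban1984PropagatorsII, (2.124), (2.126)–(2.127) p.245, (2.89) p.239] -/
theorem layerFirst_big_le (hn : 1 ≤ n) (hL : 1 ≤ L) {Λs Λb : Finset (Fin d → ℤ)} (hΛs : ∀ y ∈ Λs, ∀ i, (n : ℤ) ∣ y i)
    (hΛb : ∀ Y ∈ Λb, ∀ i, ((n * L : ℕ) : ℤ) ∣ Y i) {B : Cfg d} (hB0 : ∀ b, b ∉ bonds₂ n L Λs Λb → B b = 0)
    (hTb : ∀ Y ∈ Λb, ∀ b ∈ treeBonds (n * L) Y, B b = 0)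
    {C : (Fin d → ℤ) × Fin d} (hCN : ∀ i, ((n * L : ℕ) : ℤ) ∣ (C.1 + ((n * L : ℕ) : ℤ) • unitVec C.2) i)
    (hA : Adm n L Λs Λb (C.1 + ((n * L : ℕ) : ℤ) • unitVec C.2)) :
    ∑ b ∈ bondsIn (firstLayer (n * L) C.1 C.2), B b ^ 2 ≤
      ((d : ℝ) - 1) * (((n * L : ℕ) : ℝ) - 1) * ((n * L : ℕ) : ℝ) ^ (d - 2) *
          (if C.1 + ((n * L : ℕ) : ℤ) • unitVec C.2 ∈ Λb then
            ∑ p ∈ innerPlaq (n * L) (C.1 + ((n * L : ℕ) : ℤ) • unitVec C.2), curl B p.1 p.2.1 p.2.2 ^ 2 else 0) +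
        (if subCorners n L (C.1 + ((n * L : ℕ) : ℤ) • unitVec C.2) ⊆ Λs then compG n L B (C.1 + ((n * L : ℕ) : ℤ) • unitVec C.2) else 0) := by
  classical
  have hN : 1 ≤ n * L := Nat.mul_pos hn hL
  have hG : 0 ≤ (if subCorners n L (C.1 + ((n * L : ℕ) : ℤ) • unitVec C.2) ⊆ Λs then
      compG n L B (C.1 + ((n * L : ℕ) : ℤ) • unitVec C.2) else 0) := by
    split_ifs
    · exact compG_nonneg B _
    · exact le_rfl
  by_cases h1 : C.1 + ((n * L : ℕ) : ℤ) • unitVec C.2 ∈ Λb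
  · rw [if_pos h1]
    exact ((sum_le_sum_of_subset_of_nonneg (bondsIn_firstLayer_subset C.1 C.2) fun _ _ _ => sq_nonneg _).trans
      (layer_sq_le hN _ C.2 _ B (hTb _ h1))).trans (le_add_of_nonneg_right hG)
  rw [if_neg h1, mul_zero, zero_add]
  rcases hA with h | h | h
  · exact absurd h h1
  · rw [if_pos h]; exact sum_bondsIn_firstLayer_big_le hn C.2 rfl fun _ => sq_nonneg _
  · rw [sum_eq_zero fun b hb => by
      rw [eq_zero_of_innerBonds_bigEmpty hn hL hΛs hΛb hB0 h1 hCN h (mem_filter.1 (bondsIn_firstLayer_subset C.1 C.2 hb)).1]; ring]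
    exact hG

/-- multiplicity count: `Σ_{c ∈ S} 1_{c₋ ∈ Λ′}·F(c₋) ≤ d·Σ_{y ∈ Λ′} F(y)` for `F ≥ 0` (each `y` is `c₋` for at most `d` directions). [folklore] -/
private theorem sum_ite_fst_le (Λ' : Finset (Fin d → ℤ)) (S : Finset ((Fin d → ℤ) × Fin d)) {F : (Fin d → ℤ) → ℝ} (hF : ∀ y, 0 ≤ F y) :
    ∑ c ∈ S, (if c.1 ∈ Λ' then F c.1 else 0) ≤ (d : ℝ) * ∑ y ∈ Λ', F y := by
  classical
  rw [← sum_filter]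
  calc ∑ c ∈ S.filter (fun c => c.1 ∈ Λ'), F c.1
      ≤ ∑ c ∈ Λ' ×ˢ (univ : Finset (Fin d)), F c.1 :=
        sum_le_sum_of_subset_of_nonneg (fun c hc => mem_product.2 ⟨(mem_filter.1 hc).2, mem_univ _⟩) fun _ _ _ => hF _
    _ = (d : ℝ) * ∑ y ∈ Λ', F y := by
        rw [sum_product, mul_sum]
        refine sum_congr rfl fun y _ => ?_
        dsimp only
        rw [sum_const, card_univ, Fintype.card_fin, nsmul_eq_mul]

/-- the same with the shifted end `c₋ + t e_μ` (the map `c ↦ (c₋ + t e_μ, μ)` is injective). [folklore] -/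
private theorem sum_ite_shift_le (t : ℤ) (Λ' : Finset (Fin d → ℤ)) (S : Finset ((Fin d → ℤ) × Fin d)) {F : (Fin d → ℤ) → ℝ} (hF : ∀ y, 0 ≤ F y) :
    ∑ c ∈ S, (if c.1 + t • unitVec c.2 ∈ Λ' then F (c.1 + t • unitVec c.2) else 0) ≤ (d : ℝ) * ∑ y ∈ Λ', F y := by
  classical
  have hinj : Set.InjOn (fun c : (Fin d → ℤ) × Fin d => (c.1 + t • unitVec c.2, c.2)) ↑S := fun c _ c' _ h => by
    simp only [Prod.mk.injEq] at h
    obtain ⟨h1, h2⟩ := h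
    rw [h2] at h1
    exact Prod.ext (add_right_cancel h1) h2
  have e : ∑ c ∈ S, (if c.1 + t • unitVec c.2 ∈ Λ' then F (c.1 + t • unitVec c.2) else 0) =
      ∑ c ∈ S.image (fun c => (c.1 + t • unitVec c.2, c.2)), (if c.1 ∈ Λ' then F c.1 else 0) := by
    rw [sum_image hinj]
  rw [e]
  exact sum_ite_fst_le Λ' _ hF

/-- `Σ_{c ∈ S} F(c₋) ≤ d·Σ_{y ∈ c₋(S)} F(y)` for `F ≥ 0`. [folklore] -/
private theorem sum_fst_le_mul (S : Finset ((Fin d → ℤ) × Fin d)) {F : (Fin d → ℤ) → ℝ} (hF : ∀ y, 0 ≤ F y) :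
    ∑ c ∈ S, F c.1 ≤ (d : ℝ) * ∑ y ∈ S.image Prod.fst, F y := by
  classical
  calc ∑ c ∈ S, F c.1 = ∑ c ∈ S, (if c.1 ∈ S.image Prod.fst then F c.1 else 0) :=
        sum_congr rfl fun c hc => (if_pos (mem_image_of_mem Prod.fst hc)).symm
    _ ≤ (d : ℝ) * ∑ y ∈ S.image Prod.fst, F y := sum_ite_fst_le _ S hF

/-- the internal small faces of a composite position `Y₀`, as small coarse bonds `(s, ν)` (`s`, `s + n e_ν` both sub-corners). [cite: Balaban1984PropagatorsII, (2.89) p.239] -/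
def faceIdx (n L : ℕ) (Y₀ : Fin d → ℤ) : Finset ((Fin d → ℤ) × Fin d) :=
  (subCorners n L Y₀).biUnion fun s => (univ.filter fun ν : Fin d => s + (n : ℤ) • unitVec ν ∈ subCorners n L Y₀).image (Prod.mk s)

/-- the internal-face double sum of `compG` as a sum over `faceIdx`. [cite: Balaban1984PropagatorsII, (2.89) p.239; folklore] -/
theorem sum_faceIdx_eq (Y₀ : Fin d → ℤ) (φ : (Fin d → ℤ) × Fin d → ℝ) :
    ∑ s ∈ subCorners n L Y₀, ∑ ν ∈ univ.filter (fun ν : Fin d => s + (n : ℤ) • unitVec ν ∈ subCorners n L Y₀), φ (s, ν) =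
      ∑ c ∈ faceIdx n L Y₀, φ c := by
  classical
  rw [faceIdx, sum_biUnion]
  · refine sum_congr rfl fun s _ => ?_
    rw [sum_image fun ν _ ν' _ h => (Prod.mk.inj h).2]
  · intro s _ s' _ hss'
    refine disjoint_left.2 fun c hc hc' => hss' ?_
    obtain ⟨ν, -, rfl⟩ := mem_image.1 hc
    obtain ⟨ν', -, h⟩ := mem_image.1 hc'
    exact ((Prod.mk.inj h).1).symm

/-- the internal faces of a composite position are small indices (regions disjoint). [cite: Balaban1984PropagatorsII, (2.89) p.239; folklore] -/
theorem faceIdx_subset_idxS (hn : 1 ≤ n) (hL : 1 ≤ L) {Λs Λb : Finset (Fin d → ℤ)} (hdisj : ∀ y ∈ Λs, corner (n * L) y ∉ Λb)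
    {Y₀ : Fin d → ℤ} (hY : ∀ i, ((n * L : ℕ) : ℤ) ∣ Y₀ i) (hsub : subCorners n L Y₀ ⊆ Λs) : faceIdx n L Y₀ ⊆ idxS n L Λs Λb := by
  classical
  intro c hc
  obtain ⟨s, hs, hc⟩ := mem_biUnion.1 hc
  obtain ⟨ν, hν, rfl⟩ := mem_image.1 hc
  have hν' := (mem_filter.1 hν).2
  have hY₀ : Y₀ ∉ Λb := by
    have h := hdisj s (hsub hs)
    rwa [corner_big_of_mem_subCorners hn hL hY hs] at h
  refine mem_idxS.2 ⟨mem_coarseBonds.2 (Or.inl (hsub hs)), ?_, ?_⟩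
  · dsimp only; rw [corner_big_of_mem_subCorners hn hL hY hs]; exact hY₀
  · dsimp only; rw [corner_big_of_mem_subCorners hn hL hY hν']; exact hY₀

/-- ★★ **the composite quantities of DISTINCT composite positions sum to at most `N_in^S + crossS`** (their sub-corner sets are disjoint pieces of `Λs`, their internal
faces disjoint pieces of `idxS` — fibres of `corner_{nL}`). [cite: Balaban1984PropagatorsII, (2.89) p.239, (2.123)–(2.127) pp.244–245; folklore] -/
theorem sum_compG_le (hn : 1 ≤ n) (hL : 1 ≤ L) {Λs Λb : Finset (Fin d → ℤ)} (hdisj : ∀ y ∈ Λs, corner (n * L) y ∉ Λb) (B : Cfg d)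
    (T : Finset (Fin d → ℤ)) (hT : ∀ Y₀ ∈ T, (∀ i, ((n * L : ℕ) : ℤ) ∣ Y₀ i) ∧ subCorners n L Y₀ ⊆ Λs) :
    ∑ Y₀ ∈ T, compG n L B Y₀ ≤ nIn n Λs B + crossS n L Λs Λb B := by
  classical
  simp only [compG, sum_add_distrib]
  refine add_le_add ?_ ?_
  · -- the sub-blocks' inner sums
    have hdj : (T : Set (Fin d → ℤ)).PairwiseDisjoint (subCorners n L) := by
      intro Y hY Y' hY' hne
      refine disjoint_left.2 fun s hs hs' => hne ?_
      rw [← corner_big_of_mem_subCorners hn hL (hT Y hY).1 hs, ← corner_big_of_mem_subCorners hn hL (hT Y' hY').1 hs']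
    rw [← sum_biUnion hdj, nIn]
    refine sum_le_sum_of_subset_of_nonneg (fun s hs => ?_) fun _ _ _ => sum_nonneg fun _ _ => sq_nonneg _
    obtain ⟨Y, hY, hsY⟩ := mem_biUnion.1 hs
    exact (hT Y hY).2 hsY
  · -- the internal faces
    have hdj : (T : Set (Fin d → ℤ)).PairwiseDisjoint (faceIdx n L) := by
      intro Y hY Y' hY' hne
      refine disjoint_left.2 fun c hc hc' => hne ?_
      obtain ⟨s, hs, hc⟩ := mem_biUnion.1 hc
      obtain ⟨ν, -, rfl⟩ := mem_image.1 hc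
      obtain ⟨s', hs', hc'⟩ := mem_biUnion.1 hc'
      obtain ⟨ν', -, h⟩ := mem_image.1 hc'
      have hss : s' = s := (Prod.mk.inj h).1
      rw [hss] at hs'
      rw [← corner_big_of_mem_subCorners hn hL (hT Y hY).1 hs, ← corner_big_of_mem_subCorners hn hL (hT Y' hY').1 hs']
    have hsub : T.biUnion (faceIdx n L) ⊆ idxS n L Λs Λb := by
      intro c hc
      obtain ⟨Y₀, hY₀, hc⟩ := mem_biUnion.1 hc
      exact faceIdx_subset_idxS hn hL hdisj (hT Y₀ hY₀).1 (hT Y₀ hY₀).2 hc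
    set φ : (Fin d → ℤ) × Fin d → ℝ := fun c => ∑ z ∈ lastLayer n c.1 c.2, B (z, c.2) ^ 2 with hφ
    have hφ0 : ∀ c, 0 ≤ φ c := fun c => sum_nonneg fun _ _ => sq_nonneg _
    have e1 : ∀ Y₀ ∈ T, ∑ s ∈ subCorners n L Y₀, ∑ ν ∈ univ.filter (fun ν : Fin d => s + (n : ℤ) • unitVec ν ∈ subCorners n L Y₀),
        ∑ z ∈ lastLayer n s ν, B (z, ν) ^ 2 = ∑ c ∈ faceIdx n L Y₀, φ c := fun Y₀ _ => sum_faceIdx_eq Y₀ φ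
    rw [sum_congr rfl e1, ← sum_biUnion hdj, crossS]
    exact sum_le_sum_of_subset_of_nonneg hsub fun c _ _ => hφ0 c

/-- the composite parts over a set of big coarse bonds, read at `C₋`: `Σ_{C ∈ S} 1_{C₋ composite}·compG(C₋) ≤ d·(N_in^S + crossS)`. [cite: Balaban1984PropagatorsII, (2.89) p.239, (2.125)–(2.127) p.245; folklore] -/
theorem sum_ite_compG_le (hn : 1 ≤ n) (hL : 1 ≤ L) {Λs Λb : Finset (Fin d → ℤ)} (hdisj : ∀ y ∈ Λs, corner (n * L) y ∉ Λb) (B : Cfg d)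
    (S : Finset ((Fin d → ℤ) × Fin d)) (hS : ∀ C ∈ S, ∀ i, ((n * L : ℕ) : ℤ) ∣ C.1 i) :
    ∑ C ∈ S, (if subCorners n L C.1 ⊆ Λs then compG n L B C.1 else 0) ≤ (d : ℝ) * (nIn n Λs B + crossS n L Λs Λb B) := by
  classical
  rw [← sum_filter]
  refine (sum_fst_le_mul _ fun Y => compG_nonneg B Y).trans
    (mul_le_mul_of_nonneg_left (sum_compG_le hn hL hdisj B _ fun Y₀ hY₀ => ?_) (Nat.cast_nonneg d))
  obtain ⟨C, hC, rfl⟩ := mem_image.1 hY₀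
  obtain ⟨hC, hsub⟩ := mem_filter.1 hC
  exact ⟨hS C hC, hsub⟩

/-- the same read at the shifted end `C₊ = C₋ + nL e_μ`. [cite: Balaban1984PropagatorsII, (2.89) p.239, (2.125)–(2.127) p.245; folklore] -/
theorem sum_ite_compG_shift_le (hn : 1 ≤ n) (hL : 1 ≤ L) {Λs Λb : Finset (Fin d → ℤ)} (hdisj : ∀ y ∈ Λs, corner (n * L) y ∉ Λb) (B : Cfg d)
    (S : Finset ((Fin d → ℤ) × Fin d)) (hS : ∀ C ∈ S, ∀ i, ((n * L : ℕ) : ℤ) ∣ C.1 i) :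
    ∑ C ∈ S, (if subCorners n L (C.1 + ((n * L : ℕ) : ℤ) • unitVec C.2) ⊆ Λs then compG n L B (C.1 + ((n * L : ℕ) : ℤ) • unitVec C.2) else 0) ≤
      (d : ℝ) * (nIn n Λs B + crossS n L Λs Λb B) := by
  classical
  have hinj : Set.InjOn (fun c : (Fin d → ℤ) × Fin d => (c.1 + ((n * L : ℕ) : ℤ) • unitVec c.2, c.2)) ↑S := fun c _ c' _ h => by
    simp only [Prod.mk.injEq] at h
    obtain ⟨h1, h2⟩ := h
    rw [h2] at h1
    exact Prod.ext (add_right_cancel h1) h2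
  have e : ∑ C ∈ S, (if subCorners n L (C.1 + ((n * L : ℕ) : ℤ) • unitVec C.2) ⊆ Λs then
        compG n L B (C.1 + ((n * L : ℕ) : ℤ) • unitVec C.2) else 0) =
      ∑ C ∈ S.image (fun c => (c.1 + ((n * L : ℕ) : ℤ) • unitVec c.2, c.2)), (if subCorners n L C.1 ⊆ Λs then compG n L B C.1 else 0) := by
    rw [sum_image hinj]
  rw [e]
  refine sum_ite_compG_le hn hL hdisj B _ fun C hC i => ?_
  obtain ⟨C', hC', rfl⟩ := mem_image.1 hC
  dsimp only
  rw [add_smul_unitVec_apply]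
  exact dvd_add (hS C' hC' i) (by split_ifs <;> simp)

/-- ★★ **the `C₋` block terms of the big faces: `Σ_{C} Σ_{b ⊂ B_{nL}(C₋)} B² ≤ d·N_in^B + d·(N_in^S + crossS)`.** [cite: Balaban1984PropagatorsII, (2.125)–(2.127) p.245, (2.89) p.239] -/
theorem sum_innerMinus_big_le (hn : 1 ≤ n) (hL : 1 ≤ L) {Λs Λb : Finset (Fin d → ℤ)} (hΛs : ∀ y ∈ Λs, ∀ i, (n : ℤ) ∣ y i)
    (hΛb : ∀ Y ∈ Λb, ∀ i, ((n * L : ℕ) : ℤ) ∣ Y i) (hdisj : ∀ y ∈ Λs, corner (n * L) y ∉ Λb)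
    (hH : ∀ Y ∈ Λb, ∀ μ : Fin d, Adm n L Λs Λb (Y + ((n * L : ℕ) : ℤ) • unitVec μ) ∧ Adm n L Λs Λb (Y - ((n * L : ℕ) : ℤ) • unitVec μ))
    {B : Cfg d} (hB0 : ∀ b, b ∉ bonds₂ n L Λs Λb → B b = 0) :
    ∑ C ∈ coarseBonds (n * L) Λb, ∑ b ∈ innerBonds (n * L) C.1, B b ^ 2 ≤
      (d : ℝ) * nIn (n * L) Λb B + (d : ℝ) * (nIn n Λs B + crossS n L Λs Λb B) := by
  classical
  refine (sum_le_sum fun C hC => inner_big_le hn hL hΛs hΛb hB0 (dvd_of_mem_coarseBonds hΛb hC) (adm_fst hH hC)).trans ?_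
  rw [sum_add_distrib]
  have h1 := sum_ite_fst_le Λb (coarseBonds (n * L) Λb) (F := fun Y => ∑ b ∈ innerBonds (n * L) Y, B b ^ 2)
    fun _ => sum_nonneg fun _ _ => sq_nonneg _
  exact add_le_add h1 (sum_ite_compG_le hn hL hdisj B _ fun C hC => dvd_of_mem_coarseBonds hΛb hC)

/-- ★★ **the `C₊` block terms of the big faces: `Σ_{C} Σ_{b ⊂ B_{nL}(C₊)} B² ≤ d·N_in^B + d·(N_in^S + crossS)`.** [cite: Balaban1984PropagatorsII, (2.125)–(2.127) p.245, (2.89) p.239] -/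
theorem sum_innerPlus_big_le (hn : 1 ≤ n) (hL : 1 ≤ L) {Λs Λb : Finset (Fin d → ℤ)} (hΛs : ∀ y ∈ Λs, ∀ i, (n : ℤ) ∣ y i)
    (hΛb : ∀ Y ∈ Λb, ∀ i, ((n * L : ℕ) : ℤ) ∣ Y i) (hdisj : ∀ y ∈ Λs, corner (n * L) y ∉ Λb)
    (hH : ∀ Y ∈ Λb, ∀ μ : Fin d, Adm n L Λs Λb (Y + ((n * L : ℕ) : ℤ) • unitVec μ) ∧ Adm n L Λs Λb (Y - ((n * L : ℕ) : ℤ) • unitVec μ))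
    {B : Cfg d} (hB0 : ∀ b, b ∉ bonds₂ n L Λs Λb → B b = 0) :
    ∑ C ∈ coarseBonds (n * L) Λb, ∑ b ∈ innerBonds (n * L) (C.1 + ((n * L : ℕ) : ℤ) • unitVec C.2), B b ^ 2 ≤
      (d : ℝ) * nIn (n * L) Λb B + (d : ℝ) * (nIn n Λs B + crossS n L Λs Λb B) := by
  classical
  have hdvd : ∀ C ∈ coarseBonds (n * L) Λb, ∀ i, ((n * L : ℕ) : ℤ) ∣ (C.1 + ((n * L : ℕ) : ℤ) • unitVec C.2) i := fun C hC i => by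
    rw [add_smul_unitVec_apply]; exact dvd_add (dvd_of_mem_coarseBonds hΛb hC i) (by split_ifs <;> simp)
  refine (sum_le_sum fun C hC => inner_big_le hn hL hΛs hΛb hB0 (hdvd C hC) (adm_snd hH hC)).trans ?_
  rw [sum_add_distrib]
  have h1 := sum_ite_shift_le ((n * L : ℕ) : ℤ) Λb (coarseBonds (n * L) Λb) (F := fun Y => ∑ b ∈ innerBonds (n * L) Y, B b ^ 2)
    fun _ => sum_nonneg fun _ _ => sq_nonneg _
  exact add_le_add h1 (sum_ite_compG_shift_le hn hL hdisj B _ fun C hC => dvd_of_mem_coarseBonds hΛb hC)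

/-- ★★ **the last tangential layers of the big faces: `Σ_{C} Σ_{b ⊂ Δ′_{nL}(C)} B² ≤ (d−1)(nL−1)(nL)^{d−2}·d·P_in^B + d·(N_in^S + crossS)`.**
[cite: Balaban1984PropagatorsII, (2.124), (2.126)–(2.127) p.245, (2.89) p.239] -/
theorem sum_layerLast_big_le (hd : 1 ≤ d) (hn : 1 ≤ n) (hL : 1 ≤ L) {Λs Λb : Finset (Fin d → ℤ)} (hΛs : ∀ y ∈ Λs, ∀ i, (n : ℤ) ∣ y i)
    (hΛb : ∀ Y ∈ Λb, ∀ i, ((n * L : ℕ) : ℤ) ∣ Y i) (hdisj : ∀ y ∈ Λs, corner (n * L) y ∉ Λb)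
    (hH : ∀ Y ∈ Λb, ∀ μ : Fin d, Adm n L Λs Λb (Y + ((n * L : ℕ) : ℤ) • unitVec μ) ∧ Adm n L Λs Λb (Y - ((n * L : ℕ) : ℤ) • unitVec μ))
    {B : Cfg d} (hB0 : ∀ b, b ∉ bonds₂ n L Λs Λb → B b = 0) (hTb : ∀ Y ∈ Λb, ∀ b ∈ treeBonds (n * L) Y, B b = 0) :
    ∑ C ∈ coarseBonds (n * L) Λb, ∑ b ∈ bondsIn (lastLayer (n * L) C.1 C.2), B b ^ 2 ≤
      ((d : ℝ) - 1) * (((n * L : ℕ) : ℝ) - 1) * ((n * L : ℕ) : ℝ) ^ (d - 2) * ((d : ℝ) * pIn (n * L) Λb B) +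
        (d : ℝ) * (nIn n Λs B + crossS n L Λs Λb B) := by
  classical
  have hN : 1 ≤ n * L := Nat.mul_pos hn hL
  refine (sum_le_sum fun C hC => layerLast_big_le hn hL hΛs hΛb hB0 hTb (dvd_of_mem_coarseBonds hΛb hC) (adm_fst hH hC)).trans ?_
  rw [sum_add_distrib, ← mul_sum]
  exact add_le_add (mul_le_mul_of_nonneg_left (sum_ite_blockPlaq_le Λb B _) (layerCoeff_nonneg hd hN))
    (sum_ite_compG_le hn hL hdisj B _ fun C hC => dvd_of_mem_coarseBonds hΛb hC)

/-- ★★ **the first tangential layers of the big faces: `Σ_{C} Σ_{b ⊂ Δ″_{nL}(C)} B² ≤ (d−1)(nL−1)(nL)^{d−2}·d·P_in^B + d·(N_in^S + crossS)`.**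
[cite: Balaban1984PropagatorsII, (2.124), (2.126)–(2.127) p.245, (2.89) p.239] -/
theorem sum_layerFirst_big_le (hd : 1 ≤ d) (hn : 1 ≤ n) (hL : 1 ≤ L) {Λs Λb : Finset (Fin d → ℤ)} (hΛs : ∀ y ∈ Λs, ∀ i, (n : ℤ) ∣ y i)
    (hΛb : ∀ Y ∈ Λb, ∀ i, ((n * L : ℕ) : ℤ) ∣ Y i) (hdisj : ∀ y ∈ Λs, corner (n * L) y ∉ Λb)
    (hH : ∀ Y ∈ Λb, ∀ μ : Fin d, Adm n L Λs Λb (Y + ((n * L : ℕ) : ℤ) • unitVec μ) ∧ Adm n L Λs Λb (Y - ((n * L : ℕ) : ℤ) • unitVec μ))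
    {B : Cfg d} (hB0 : ∀ b, b ∉ bonds₂ n L Λs Λb → B b = 0) (hTb : ∀ Y ∈ Λb, ∀ b ∈ treeBonds (n * L) Y, B b = 0) :
    ∑ C ∈ coarseBonds (n * L) Λb, ∑ b ∈ bondsIn (firstLayer (n * L) C.1 C.2), B b ^ 2 ≤
      ((d : ℝ) - 1) * (((n * L : ℕ) : ℝ) - 1) * ((n * L : ℕ) : ℝ) ^ (d - 2) * ((d : ℝ) * pIn (n * L) Λb B) +
        (d : ℝ) * (nIn n Λs B + crossS n L Λs Λb B) := by
  classical
  have hN : 1 ≤ n * L := Nat.mul_pos hn hL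
  have hdvd : ∀ C ∈ coarseBonds (n * L) Λb, ∀ i, ((n * L : ℕ) : ℤ) ∣ (C.1 + ((n * L : ℕ) : ℤ) • unitVec C.2) i := fun C hC i => by
    rw [add_smul_unitVec_apply]; exact dvd_add (dvd_of_mem_coarseBonds hΛb hC i) (by split_ifs <;> simp)
  refine (sum_le_sum fun C hC => layerFirst_big_le hn hL hΛs hΛb hB0 hTb (hdvd C hC) (adm_snd hH hC)).trans ?_
  rw [sum_add_distrib, ← mul_sum]
  refine add_le_add (mul_le_mul_of_nonneg_left ?_ (layerCoeff_nonneg hd hN))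
    (sum_ite_compG_shift_le hn hL hdisj B _ fun C hC => dvd_of_mem_coarseBonds hΛb hC)
  have h := sum_ite_shift_le ((n * L : ℕ) : ℤ) Λb (coarseBonds (n * L) Λb)
    (F := fun Y => ∑ p ∈ innerPlaq (n * L) Y, curl B p.1 p.2.1 p.2.2 ^ 2) fun _ => sum_nonneg fun _ _ => sq_nonneg _
  rw [pIn]
  exact h

/-! ## §6 (v1.1, append-only). ADMISSIBILITY-FREE absorptions: an end of a big face outside `Λb` is a GENERALISED composite position — its sub-blocks outside `Λs`
and its internal faces not meeting `Λs` carry `B = 0` («B = 0 outside Λ»), so the trichotomy `Adm` is not needed -/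

/-- a sub-corner is an `n`-lattice point. [cite: Balaban1984PropagatorsII, (2.89) p.239; folklore] -/
theorem dvd_of_mem_subCorners {Y₀ s : Fin d → ℤ} (hs : s ∈ subCorners n L Y₀) (i : Fin d) : (n : ℤ) ∣ s i := by
  obtain ⟨z, -, rfl⟩ := mem_subCorners_iff.1 hs
  rw [corner_apply]; exact dvd_mul_right _ _

/-- ★ the crossing sum of an internal face of a position `Y₀ ∉ Λb` NOT meeting `Λs` vanishes (its bonds join two small blocks outside `Λs` inside a position outside `Λb`).
[cite: Balaban1984PropagatorsII, Lemma 2.4 p.245 («B = 0 outside Λ»), (2.89) p.239; folklore] -/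
theorem face_sum_eq_zero_of_not_mem (hn : 1 ≤ n) (hL : 1 ≤ L) {Λs Λb : Finset (Fin d → ℤ)} (hΛs : ∀ y ∈ Λs, ∀ i, (n : ℤ) ∣ y i)
    (hΛb : ∀ Y ∈ Λb, ∀ i, ((n * L : ℕ) : ℤ) ∣ Y i) {B : Cfg d} (hB0 : ∀ b, b ∉ bonds₂ n L Λs Λb → B b = 0)
    {Y₀ : Fin d → ℤ} (hY : ∀ i, ((n * L : ℕ) : ℤ) ∣ Y₀ i) (hY₀ : Y₀ ∉ Λb) {c : (Fin d → ℤ) × Fin d} (hc : c ∈ faceIdx n L Y₀)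
    (hcn : c ∉ coarseBonds n Λs) : ∑ z ∈ lastLayer n c.1 c.2, B (z, c.2) ^ 2 = 0 := by
  classical
  have hN : 0 < n * L := Nat.mul_pos hn hL
  obtain ⟨s, hs, hc'⟩ := mem_biUnion.1 hc
  obtain ⟨ν, hν, rfl⟩ := mem_image.1 hc'
  have hν' : s + (n : ℤ) • unitVec ν ∈ subCorners n L Y₀ := (mem_filter.1 hν).2
  have hs1 : s ∉ Λs := fun h => hcn (mem_coarseBonds.2 (Or.inl h))
  have hs2 : s + (n : ℤ) • unitVec ν ∉ Λs := fun h => hcn (mem_coarseBonds.2 (Or.inr h))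
  have hsn : ∀ i, (n : ℤ) ∣ s i := dvd_of_mem_subCorners hs
  have hsn' : ∀ i, (n : ℤ) ∣ (s + (n : ℤ) • unitVec ν) i := dvd_of_mem_subCorners hν'
  have hcs : corner (n * L) s = Y₀ := corner_big_of_mem_subCorners hn hL hY hs
  have hcs' : corner (n * L) (s + (n : ℤ) • unitVec ν) = Y₀ := corner_big_of_mem_subCorners hn hL hY hν'
  refine sum_eq_zero fun z hz => ?_
  have hz1 : z ∈ block n s := lastLayer_subset_block _ _ hz
  have hz2 : z + unitVec ν ∈ block n (s + (n : ℤ) • unitVec ν) := firstLayer_subset_block _ _ ((add_unitVec_mem_firstLayer hn).2 hz)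
  rw [hB0 (z, ν) fun h => ?_]
  · ring
  rcases mem_union.1 h with h | h <;> rcases mem_lamBonds.1 h with h | h
  · obtain ⟨y, hy, hzy⟩ := mem_lam.1 h
    exact hs1 (by rw [eq_of_mem_block hn hsn (hΛs y hy) hz1 hzy]; exact hy)
  · obtain ⟨y, hy, hzy⟩ := mem_lam.1 h
    exact hs2 (by rw [eq_of_mem_block hn hsn' (hΛs y hy) hz2 hzy]; exact hy)
  · obtain ⟨Y, hYb, hzY⟩ := mem_lam.1 h
    exact hY₀ (by rw [← hcs, eq_of_mem_block hN (dvd_corner_big' s) (hΛb Y hYb) (small_block_subset_big hn hL hsn hz1) hzY]; exact hYb)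
  · obtain ⟨Y, hYb, hzY⟩ := mem_lam.1 h
    exact hY₀ (by rw [← hcs', eq_of_mem_block hN (dvd_corner_big' _) (hΛb Y hYb) (small_block_subset_big hn hL hsn' hz2) hzY]; exact hYb)

/-- an internal face of a position `Y₀ ∉ Λb` that meets `Λs` is a small index. [cite: Balaban1984PropagatorsII, (2.89) p.239; folklore] -/
theorem mem_idxS_of_mem_faceIdx (hn : 1 ≤ n) (hL : 1 ≤ L) {Λs Λb : Finset (Fin d → ℤ)} {Y₀ : Fin d → ℤ} (hY : ∀ i, ((n * L : ℕ) : ℤ) ∣ Y₀ i)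
    (hY₀ : Y₀ ∉ Λb) {c : (Fin d → ℤ) × Fin d} (hc : c ∈ faceIdx n L Y₀) (hcb : c ∈ coarseBonds n Λs) : c ∈ idxS n L Λs Λb := by
  classical
  obtain ⟨s, hs, hc'⟩ := mem_biUnion.1 hc
  obtain ⟨ν, hν, rfl⟩ := mem_image.1 hc'
  have hν' := (mem_filter.1 hν).2
  refine mem_idxS.2 ⟨hcb, ?_, ?_⟩
  · dsimp only; rw [corner_big_of_mem_subCorners hn hL hY hs]; exact hY₀
  · dsimp only; rw [corner_big_of_mem_subCorners hn hL hY hν']; exact hY₀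

/-- ★★ **ADMISSIBILITY-FREE: the composite quantities of distinct positions OUTSIDE `Λb` sum to at most `N_in^S + crossS`** (sub-blocks outside `Λs` have vanishing inner
sums, internal faces not meeting `Λs` vanishing crossing sums; the rest are pieces of `N_in^S` ∕ `crossS` as in `sum_compG_le`).
[cite: Balaban1984PropagatorsII, (2.89) p.239, (2.123)–(2.127) pp.244–245, Lemma 2.4 p.245 («B = 0 outside Λ»); folklore] -/
theorem sum_compG_le_noAdm (hn : 1 ≤ n) (hL : 1 ≤ L) {Λs Λb : Finset (Fin d → ℤ)} (hΛs : ∀ y ∈ Λs, ∀ i, (n : ℤ) ∣ y i)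
    (hΛb : ∀ Y ∈ Λb, ∀ i, ((n * L : ℕ) : ℤ) ∣ Y i) {B : Cfg d} (hB0 : ∀ b, b ∉ bonds₂ n L Λs Λb → B b = 0)
    (T : Finset (Fin d → ℤ)) (hT : ∀ Y₀ ∈ T, (∀ i, ((n * L : ℕ) : ℤ) ∣ Y₀ i) ∧ Y₀ ∉ Λb) :
    ∑ Y₀ ∈ T, compG n L B Y₀ ≤ nIn n Λs B + crossS n L Λs Λb B := by
  classical
  simp only [compG, sum_add_distrib]
  refine add_le_add ?_ ?_
  · -- the sub-blocks' inner sums: those outside `Λs` vanish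
    have hdj : (T : Set (Fin d → ℤ)).PairwiseDisjoint (subCorners n L) := by
      intro Y hY Y' hY' hne
      refine disjoint_left.2 fun s hs hs' => hne ?_
      rw [← corner_big_of_mem_subCorners hn hL (hT Y hY).1 hs, ← corner_big_of_mem_subCorners hn hL (hT Y' hY').1 hs']
    rw [← sum_biUnion hdj, ← sum_filter_add_sum_filter_not (T.biUnion (subCorners n L)) (fun s => s ∈ Λs)]
    have h0 : ∑ s ∈ (T.biUnion (subCorners n L)).filter (fun s => ¬ s ∈ Λs), ∑ b ∈ innerBonds n s, B b ^ 2 = 0 := by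
      refine sum_eq_zero fun s hs => sum_eq_zero fun b hb => ?_
      obtain ⟨hsU, hsΛ⟩ := mem_filter.1 hs
      obtain ⟨Y₀, hY₀, hsY⟩ := mem_biUnion.1 hsU
      have hcs : corner (n * L) s = Y₀ := corner_big_of_mem_subCorners hn hL (hT Y₀ hY₀).1 hsY
      rw [eq_zero_of_innerBonds_small hn hL hΛs hΛb hB0 hsΛ (dvd_of_mem_subCorners hsY) (by rw [hcs]; exact (hT Y₀ hY₀).2) hb]
      ring
    rw [h0, add_zero, nIn]
    exact sum_le_sum_of_subset_of_nonneg (fun s hs => (mem_filter.1 hs).2) fun _ _ _ => sum_nonneg fun _ _ => sq_nonneg _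
  · -- the internal faces: those not meeting `Λs` vanish, the others are small indices
    have hdj : (T : Set (Fin d → ℤ)).PairwiseDisjoint (faceIdx n L) := by
      intro Y hY Y' hY' hne
      refine disjoint_left.2 fun c hc hc' => hne ?_
      obtain ⟨s, hs, hc⟩ := mem_biUnion.1 hc
      obtain ⟨ν, -, rfl⟩ := mem_image.1 hc
      obtain ⟨s', hs', hc'⟩ := mem_biUnion.1 hc'
      obtain ⟨ν', -, h⟩ := mem_image.1 hc'
      have hss : s' = s := (Prod.mk.inj h).1
      rw [hss] at hs'
      rw [← corner_big_of_mem_subCorners hn hL (hT Y hY).1 hs, ← corner_big_of_mem_subCorners hn hL (hT Y' hY').1 hs']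
    set φ : (Fin d → ℤ) × Fin d → ℝ := fun c => ∑ z ∈ lastLayer n c.1 c.2, B (z, c.2) ^ 2 with hφ
    have hφ0 : ∀ c, 0 ≤ φ c := fun c => sum_nonneg fun _ _ => sq_nonneg _
    have e1 : ∀ Y₀ ∈ T, ∑ s ∈ subCorners n L Y₀, ∑ ν ∈ univ.filter (fun ν : Fin d => s + (n : ℤ) • unitVec ν ∈ subCorners n L Y₀),
        ∑ z ∈ lastLayer n s ν, B (z, ν) ^ 2 = ∑ c ∈ faceIdx n L Y₀, φ c := fun Y₀ _ => sum_faceIdx_eq Y₀ φ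
    rw [sum_congr rfl e1, ← sum_biUnion hdj, ← sum_filter_add_sum_filter_not (T.biUnion (faceIdx n L)) (fun c => c ∈ coarseBonds n Λs), crossS]
    have h0 : ∑ c ∈ (T.biUnion (faceIdx n L)).filter (fun c => ¬ c ∈ coarseBonds n Λs), φ c = 0 := by
      refine sum_eq_zero fun c hc => ?_
      obtain ⟨hcU, hcn⟩ := mem_filter.1 hc
      obtain ⟨Y₀, hY₀, hcY⟩ := mem_biUnion.1 hcU
      exact face_sum_eq_zero_of_not_mem hn hL hΛs hΛb hB0 (hT Y₀ hY₀).1 (hT Y₀ hY₀).2 hcY hcn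
    rw [h0, add_zero]
    refine sum_le_sum_of_subset_of_nonneg (fun c hc => ?_) fun c _ _ => hφ0 c
    obtain ⟨hcU, hcb⟩ := mem_filter.1 hc
    obtain ⟨Y₀, hY₀, hcY⟩ := mem_biUnion.1 hcU
    exact mem_idxS_of_mem_faceIdx hn hL (hT Y₀ hY₀).1 (hT Y₀ hY₀).2 hcY hcb

/-- the composite parts over a set of big coarse bonds at the ends OUTSIDE `Λb`, read at `C₋` (admissibility-free). [cite: Balaban1984PropagatorsII, (2.89) p.239, (2.125)–(2.127) p.245; folklore] -/
theorem sum_ite_compG_le_noAdm (hn : 1 ≤ n) (hL : 1 ≤ L) {Λs Λb : Finset (Fin d → ℤ)} (hΛs : ∀ y ∈ Λs, ∀ i, (n : ℤ) ∣ y i)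
    (hΛb : ∀ Y ∈ Λb, ∀ i, ((n * L : ℕ) : ℤ) ∣ Y i) {B : Cfg d} (hB0 : ∀ b, b ∉ bonds₂ n L Λs Λb → B b = 0)
    (S : Finset ((Fin d → ℤ) × Fin d)) (hS : ∀ C ∈ S, ∀ i, ((n * L : ℕ) : ℤ) ∣ C.1 i) :
    ∑ C ∈ S, (if C.1 ∉ Λb then compG n L B C.1 else 0) ≤ (d : ℝ) * (nIn n Λs B + crossS n L Λs Λb B) := by
  classical
  rw [← sum_filter]
  refine (sum_fst_le_mul _ fun Y => compG_nonneg B Y).trans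
    (mul_le_mul_of_nonneg_left (sum_compG_le_noAdm hn hL hΛs hΛb hB0 _ fun Y₀ hY₀ => ?_) (Nat.cast_nonneg d))
  obtain ⟨C, hC, rfl⟩ := mem_image.1 hY₀
  obtain ⟨hC, hnot⟩ := mem_filter.1 hC
  exact ⟨hS C hC, hnot⟩

/-- the same read at the shifted end `C₊ = C₋ + nL e_μ` (admissibility-free). [cite: Balaban1984PropagatorsII, (2.89) p.239, (2.125)–(2.127) p.245; folklore] -/
theorem sum_ite_compG_shift_le_noAdm (hn : 1 ≤ n) (hL : 1 ≤ L) {Λs Λb : Finset (Fin d → ℤ)} (hΛs : ∀ y ∈ Λs, ∀ i, (n : ℤ) ∣ y i)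
    (hΛb : ∀ Y ∈ Λb, ∀ i, ((n * L : ℕ) : ℤ) ∣ Y i) {B : Cfg d} (hB0 : ∀ b, b ∉ bonds₂ n L Λs Λb → B b = 0)
    (S : Finset ((Fin d → ℤ) × Fin d)) (hS : ∀ C ∈ S, ∀ i, ((n * L : ℕ) : ℤ) ∣ C.1 i) :
    ∑ C ∈ S, (if C.1 + ((n * L : ℕ) : ℤ) • unitVec C.2 ∉ Λb then compG n L B (C.1 + ((n * L : ℕ) : ℤ) • unitVec C.2) else 0) ≤
      (d : ℝ) * (nIn n Λs B + crossS n L Λs Λb B) := by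
  classical
  have hinj : Set.InjOn (fun c : (Fin d → ℤ) × Fin d => (c.1 + ((n * L : ℕ) : ℤ) • unitVec c.2, c.2)) ↑S := fun c _ c' _ h => by
    simp only [Prod.mk.injEq] at h
    obtain ⟨h1, h2⟩ := h
    rw [h2] at h1
    exact Prod.ext (add_right_cancel h1) h2
  have e : ∑ C ∈ S, (if C.1 + ((n * L : ℕ) : ℤ) • unitVec C.2 ∉ Λb then compG n L B (C.1 + ((n * L : ℕ) : ℤ) • unitVec C.2) else 0) =
      ∑ C ∈ S.image (fun c => (c.1 + ((n * L : ℕ) : ℤ) • unitVec c.2, c.2)), (if C.1 ∉ Λb then compG n L B C.1 else 0) := by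
    rw [sum_image hinj]
  rw [e]
  refine sum_ite_compG_le_noAdm hn hL hΛs hΛb hB0 _ fun C hC i => ?_
  obtain ⟨C', hC', rfl⟩ := mem_image.1 hC
  dsimp only
  rw [add_smul_unitVec_apply]
  exact dvd_add (hS C' hC' i) (by split_ifs <;> simp)

/-- ★ per `nL`-position, NO admissibility: `Σ_{b ⊂ B_{nL}(Y)} B² ≤ 1_{Y ∈ Λb}·(the same) + 1_{Y ∉ Λb}·compG(Y)` (C6a `sum_innerBonds_big_le` is unconditional).
[cite: Balaban1984PropagatorsII, (2.89) p.239, (2.125)–(2.127) p.245] -/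
theorem inner_big_le_noAdm (hn : 1 ≤ n) (Λb : Finset (Fin d → ℤ)) (B : Cfg d) (Y : Fin d → ℤ) :
    ∑ b ∈ innerBonds (n * L) Y, B b ^ 2 ≤
      (if Y ∈ Λb then ∑ b ∈ innerBonds (n * L) Y, B b ^ 2 else 0) + (if Y ∉ Λb then compG n L B Y else 0) := by
  classical
  by_cases h1 : Y ∈ Λb
  · rw [if_pos h1, if_neg (not_not.2 h1), add_zero]
  · rw [if_neg h1, if_pos h1, zero_add]; exact sum_innerBonds_big_le hn Y fun _ => sq_nonneg _

/-- ★ per big coarse bond, the last tangential layer, NO admissibility. [cite: Balaban1984PropagatorsII, (2.124), (2.126)–(2.127) p.245, (2.89) p.239] -/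
theorem layerLast_big_le_noAdm (hn : 1 ≤ n) (hL : 1 ≤ L) {Λb : Finset (Fin d → ℤ)} {B : Cfg d} (hTb : ∀ Y ∈ Λb, ∀ b ∈ treeBonds (n * L) Y, B b = 0)
    (C : (Fin d → ℤ) × Fin d) :
    ∑ b ∈ bondsIn (lastLayer (n * L) C.1 C.2), B b ^ 2 ≤
      ((d : ℝ) - 1) * (((n * L : ℕ) : ℝ) - 1) * ((n * L : ℕ) : ℝ) ^ (d - 2) *
          (if C.1 ∈ Λb then ∑ p ∈ innerPlaq (n * L) C.1, curl B p.1 p.2.1 p.2.2 ^ 2 else 0) +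
        (if C.1 ∉ Λb then compG n L B C.1 else 0) := by
  classical
  have hN : 1 ≤ n * L := Nat.mul_pos hn hL
  by_cases h1 : C.1 ∈ Λb
  · rw [if_pos h1, if_neg (not_not.2 h1), add_zero]
    exact (sum_le_sum_of_subset_of_nonneg (bondsIn_lastLayer_subset C.1 C.2) fun _ _ _ => sq_nonneg _).trans (layer_sq_le hN C.1 C.2 _ B (hTb C.1 h1))
  · rw [if_neg h1, if_pos h1, mul_zero, zero_add]; exact sum_bondsIn_lastLayer_big_le hn C.1 C.2 fun _ => sq_nonneg _

/-- ★ per big coarse bond, the first tangential layer, NO admissibility. [cite: Balaban1984PropagatorsII, (2.124), (2.126)–(2.127) p.245, (2.89) p.239] -/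
theorem layerFirst_big_le_noAdm (hn : 1 ≤ n) (hL : 1 ≤ L) {Λb : Finset (Fin d → ℤ)} {B : Cfg d} (hTb : ∀ Y ∈ Λb, ∀ b ∈ treeBonds (n * L) Y, B b = 0)
    (C : (Fin d → ℤ) × Fin d) :
    ∑ b ∈ bondsIn (firstLayer (n * L) C.1 C.2), B b ^ 2 ≤
      ((d : ℝ) - 1) * (((n * L : ℕ) : ℝ) - 1) * ((n * L : ℕ) : ℝ) ^ (d - 2) *
          (if C.1 + ((n * L : ℕ) : ℤ) • unitVec C.2 ∈ Λb then
            ∑ p ∈ innerPlaq (n * L) (C.1 + ((n * L : ℕ) : ℤ) • unitVec C.2), curl B p.1 p.2.1 p.2.2 ^ 2 else 0) +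
        (if C.1 + ((n * L : ℕ) : ℤ) • unitVec C.2 ∉ Λb then compG n L B (C.1 + ((n * L : ℕ) : ℤ) • unitVec C.2) else 0) := by
  classical
  have hN : 1 ≤ n * L := Nat.mul_pos hn hL
  by_cases h1 : C.1 + ((n * L : ℕ) : ℤ) • unitVec C.2 ∈ Λb
  · rw [if_pos h1, if_neg (not_not.2 h1), add_zero]
    exact (sum_le_sum_of_subset_of_nonneg (bondsIn_firstLayer_subset C.1 C.2) fun _ _ _ => sq_nonneg _).trans (layer_sq_le hN _ C.2 _ B (hTb _ h1))
  · rw [if_neg h1, if_pos h1, mul_zero, zero_add]; exact sum_bondsIn_firstLayer_big_le hn C.2 rfl fun _ => sq_nonneg _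

/-- ★★ the `C₋` block terms of the big faces, NO admissibility: `≤ d·N_in^B + d·(N_in^S + crossS)`. [cite: Balaban1984PropagatorsII, (2.125)–(2.127) p.245, (2.89) p.239] -/
theorem sum_innerMinus_big_le_noAdm (hn : 1 ≤ n) (hL : 1 ≤ L) {Λs Λb : Finset (Fin d → ℤ)} (hΛs : ∀ y ∈ Λs, ∀ i, (n : ℤ) ∣ y i)
    (hΛb : ∀ Y ∈ Λb, ∀ i, ((n * L : ℕ) : ℤ) ∣ Y i) {B : Cfg d} (hB0 : ∀ b, b ∉ bonds₂ n L Λs Λb → B b = 0) :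
    ∑ C ∈ coarseBonds (n * L) Λb, ∑ b ∈ innerBonds (n * L) C.1, B b ^ 2 ≤
      (d : ℝ) * nIn (n * L) Λb B + (d : ℝ) * (nIn n Λs B + crossS n L Λs Λb B) := by
  classical
  refine (sum_le_sum fun C _ => inner_big_le_noAdm (L := L) hn Λb B C.1).trans ?_
  rw [sum_add_distrib]
  have h1 := sum_ite_fst_le Λb (coarseBonds (n * L) Λb) (F := fun Y => ∑ b ∈ innerBonds (n * L) Y, B b ^ 2)
    fun _ => sum_nonneg fun _ _ => sq_nonneg _
  exact add_le_add h1 (sum_ite_compG_le_noAdm hn hL hΛs hΛb hB0 _ fun C hC => dvd_of_mem_coarseBonds hΛb hC)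

/-- ★★ the `C₊` block terms of the big faces, NO admissibility. [cite: Balaban1984PropagatorsII, (2.125)–(2.127) p.245, (2.89) p.239] -/
theorem sum_innerPlus_big_le_noAdm (hn : 1 ≤ n) (hL : 1 ≤ L) {Λs Λb : Finset (Fin d → ℤ)} (hΛs : ∀ y ∈ Λs, ∀ i, (n : ℤ) ∣ y i)
    (hΛb : ∀ Y ∈ Λb, ∀ i, ((n * L : ℕ) : ℤ) ∣ Y i) {B : Cfg d} (hB0 : ∀ b, b ∉ bonds₂ n L Λs Λb → B b = 0) :
    ∑ C ∈ coarseBonds (n * L) Λb, ∑ b ∈ innerBonds (n * L) (C.1 + ((n * L : ℕ) : ℤ) • unitVec C.2), B b ^ 2 ≤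
      (d : ℝ) * nIn (n * L) Λb B + (d : ℝ) * (nIn n Λs B + crossS n L Λs Λb B) := by
  classical
  refine (sum_le_sum fun C _ => inner_big_le_noAdm (L := L) hn Λb B (C.1 + ((n * L : ℕ) : ℤ) • unitVec C.2)).trans ?_
  rw [sum_add_distrib]
  have h1 := sum_ite_shift_le ((n * L : ℕ) : ℤ) Λb (coarseBonds (n * L) Λb) (F := fun Y => ∑ b ∈ innerBonds (n * L) Y, B b ^ 2)
    fun _ => sum_nonneg fun _ _ => sq_nonneg _
  exact add_le_add h1 (sum_ite_compG_shift_le_noAdm hn hL hΛs hΛb hB0 _ fun C hC => dvd_of_mem_coarseBonds hΛb hC)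

/-- ★★ the last tangential layers of the big faces, NO admissibility. [cite: Balaban1984PropagatorsII, (2.124), (2.126)–(2.127) p.245, (2.89) p.239] -/
theorem sum_layerLast_big_le_noAdm (hd : 1 ≤ d) (hn : 1 ≤ n) (hL : 1 ≤ L) {Λs Λb : Finset (Fin d → ℤ)} (hΛs : ∀ y ∈ Λs, ∀ i, (n : ℤ) ∣ y i)
    (hΛb : ∀ Y ∈ Λb, ∀ i, ((n * L : ℕ) : ℤ) ∣ Y i) {B : Cfg d} (hB0 : ∀ b, b ∉ bonds₂ n L Λs Λb → B b = 0)
    (hTb : ∀ Y ∈ Λb, ∀ b ∈ treeBonds (n * L) Y, B b = 0) :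
    ∑ C ∈ coarseBonds (n * L) Λb, ∑ b ∈ bondsIn (lastLayer (n * L) C.1 C.2), B b ^ 2 ≤
      ((d : ℝ) - 1) * (((n * L : ℕ) : ℝ) - 1) * ((n * L : ℕ) : ℝ) ^ (d - 2) * ((d : ℝ) * pIn (n * L) Λb B) +
        (d : ℝ) * (nIn n Λs B + crossS n L Λs Λb B) := by
  classical
  have hN : 1 ≤ n * L := Nat.mul_pos hn hL
  refine (sum_le_sum fun C _ => layerLast_big_le_noAdm hn hL hTb C).trans ?_
  rw [sum_add_distrib, ← mul_sum]
  exact add_le_add (mul_le_mul_of_nonneg_left (sum_ite_blockPlaq_le Λb B _) (layerCoeff_nonneg hd hN))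
    (sum_ite_compG_le_noAdm hn hL hΛs hΛb hB0 _ fun C hC => dvd_of_mem_coarseBonds hΛb hC)

/-- ★★ the first tangential layers of the big faces, NO admissibility. [cite: Balaban1984PropagatorsII, (2.124), (2.126)–(2.127) p.245, (2.89) p.239] -/
theorem sum_layerFirst_big_le_noAdm (hd : 1 ≤ d) (hn : 1 ≤ n) (hL : 1 ≤ L) {Λs Λb : Finset (Fin d → ℤ)} (hΛs : ∀ y ∈ Λs, ∀ i, (n : ℤ) ∣ y i)
    (hΛb : ∀ Y ∈ Λb, ∀ i, ((n * L : ℕ) : ℤ) ∣ Y i) {B : Cfg d} (hB0 : ∀ b, b ∉ bonds₂ n L Λs Λb → B b = 0)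
    (hTb : ∀ Y ∈ Λb, ∀ b ∈ treeBonds (n * L) Y, B b = 0) :
    ∑ C ∈ coarseBonds (n * L) Λb, ∑ b ∈ bondsIn (firstLayer (n * L) C.1 C.2), B b ^ 2 ≤
      ((d : ℝ) - 1) * (((n * L : ℕ) : ℝ) - 1) * ((n * L : ℕ) : ℝ) ^ (d - 2) * ((d : ℝ) * pIn (n * L) Λb B) +
        (d : ℝ) * (nIn n Λs B + crossS n L Λs Λb B) := by
  classical
  have hN : 1 ≤ n * L := Nat.mul_pos hn hL
  refine (sum_le_sum fun C _ => layerFirst_big_le_noAdm hn hL hTb C).trans ?_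
  rw [sum_add_distrib, ← mul_sum]
  refine add_le_add (mul_le_mul_of_nonneg_left ?_ (layerCoeff_nonneg hd hN))
    (sum_ite_compG_shift_le_noAdm hn hL hΛs hΛb hB0 _ fun C hC => dvd_of_mem_coarseBonds hΛb hC)
  have h := sum_ite_shift_le ((n * L : ℕ) : ℤ) Λb (coarseBonds (n * L) Λb)
    (F := fun Y => ∑ p ∈ innerPlaq (n * L) Y, curl B p.1 p.2.1 p.2.2 ^ 2) fun _ => sum_nonneg fun _ _ => sq_nonneg _
  rw [pIn]
  exact h

end

end Literature.MathematicalPhysics.QuantumFieldTheory.Balaban1983to89.B6Lemma24TwoScaleBookkeeping
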